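import Literature.NumberTheory.Transcendental.CurvePeriodsEllipticTranslationProofs
import Literature.NumberTheory.EllipticCurves.CMTransformationPolynomials
import HarnessLib

/-!
# Periods of curve type on an elliptic curve, XII: complex multiplication as functoriality

Companion of `Literature/NumberTheory/Transcendental/CurvePeriods.lean` (Huber–Wüstholz 2022,
Thm. 13.3 (2) = Kontsevich's period conjecture for periods of curve type, rendered on explicit
period symbols `(Z, ω, γ)` with the elementary relations (R1)–(R5); general statement: the named
fact `HuberWustholzCurvePeriods`). Theorem 13.3 (2) says that all `ℚ̄`-linear relations between
periods of curve type are induced by bilinearity and FUNCTORIALITY of pairs. For an elliptic curve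
with complex multiplication the relations `ω₂ = τω₁` and Masser's relation between `η₁, η₂`
(Masser 1975, Lemma 3.1) are of this kind: they are induced by the endomorphism `[α] : E → E`.
This file writes `[α]` as a morphism of pairs in the rendering and proves the two resulting
elementary relations, for the affine Weierstrass curve `E_L : y² = x³ − (g₂/4)x − g₃/4` of a period
pair `L` with `g₂, g₃ ∈ ℚ̄` and ANY complex multiplication `α` (`α ≠ 0`, `αΛ ⊆ Λ`; for `α ∈ ℤ`
these are the multiplication-by-`n` relations):

* `Ell.CMReps L α S` — kernel data: a system of representatives `S ∋ 0` of `α⁻¹Λ/Λ`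
  (`PeriodPair.exists_reps_of_mul_mem`, `exists_cmReps`); `α` is algebraic
  (`CMReps.isAlgebraic`, a root of `X² − (a + d)X + (ad − bc)`), the `φ(c)`, `c ∈ S ∖ 0`, are
  algebraic torsion points (`CMReps.isAlgPt_rep`);
* `Ell.curveC L S = C_α = {(x, y, w) | y² = x³ + Ax + B, w·Q(x) = 1} ⊂ 𝔸³`,
  `Q = ∏_{c ∈ S ∖ 0} (x − ℘(c))²` — `E_L` minus `ker [α]`, a smooth affine curve over `ℚ̄`
  (`CMReps.smoothC`), parametrised by `ψ(z) = (℘(z), ℘′(z)/2, Q(℘ z)⁻¹)`, `αz ∉ Λ`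
  (`exists_psiC_eq`, `vanishesOn_curveC_of_psi`);
* `Ell.cmul L α S = [α] : C_α → E_L` as a POLYNOMIAL map `(P(x)w, (2α)⁻¹ V(P(x)w))` with `P`
  the transformation polynomial of Cox, Thm. 10.14 (`℘(αz) = P(℘ z)/Q(℘ z)`, from the tree's
  transformation formula `α²℘(αz) = Σ_{c ∈ S} ℘(z − c) − Σ_{c ≠ 0} ℘(c)`,
  `PeriodPair.weierstrassP_mul_eq_sum_sub`) and `V` the polynomial vector field restricting to
  `ψ′`: `[α](ψ(z)) = φ(αz)` (`CMReps.cmul_psiC`), so `[α]` maps algebraic points to algebraic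
  points (`CMReps.isAlgPt_mul`);
* the identities of forms on `C_α` (relation (R2)): `[α]^*θ₀ = α ι^*θ₀`
  (`CMReps.vanishesOn_nuC0`, `θ₀ = dx/y`) and
  `[α]^*θ₁ = (|S|/α) ι^*θ₁ − (K/α) ι^*θ₀ − dG` (`CMReps.vanishesOn_nuC1`, `θ₁ = x dx/y`,
  `K = Σ_{c ≠ 0} ℘(c)`, `G = (2/α) Σ_{c ≠ 0} (ζ(z − c) − ζ(z) + ζ(c))` written as a polynomial in
  `(x, y, w)` through the addition theorem for `ζ`);
* **the CM relations** (`CMReps.span_cmul_theta0`, `CMReps.span_cmul_theta1`): for every `C¹`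
  map `g : [0,1] → ℂ` avoiding `α⁻¹Λ` with algebraic end points,
  `(E_L, θ₀, φ∘(αg)) ∼ α (E_L, θ₀, φ∘g)` and
  `(E_L, θ₁, φ∘(αg)) ∼ (|S|/α)(E_L, θ₁, φ∘g) − (K/α)(E_L, θ₀, φ∘g) − (G(ψ(g 1)) − G(ψ(g 0)))·𝟙`
  modulo the `ℚ̄`-span of (R1)–(R5) — functoriality (R4) along `[α]` and along `ι : C_α → E_L`,
  (R2) for the identities, (R3) for `dG`.

The template is `CurvePeriodsEllipticTranslationProofs.lean` (translations `τ_P` as (R4) on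
`E ∖ {O, ±P} ⊂ 𝔸³`). The consequences for closed paths on CM curves (`ω₂`-loops are
`ℚ̄`-combinations of `ω₁`-loops modulo the relations; Theorem 13.3 (2) for closed paths on a CM
elliptic curve from Masser's `masser_ellipticPeriods_cm_holds`) are drawn in
`CurvePeriodsEllipticCMLoopsProofs.lean`.

## References

* A. Huber, G. Wüstholz, *Transcendence and Linear Relations of 1-Periods*, Cambridge Tracts in
  Mathematics 227, CUP 2022 [HuberWustholz2022]: Thm. 13.3 (2) (p. 121 of the held text), §13.1
  (A)–(B) (p. 120), §13.2 (pp. 122–125), §18.1 (p. 160).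
* D. A. Cox, *Primes of the form x² + ny²*, 2nd ed., Wiley 2013, §10.B Thm. 10.14 (`℘(αz)` is a
  rational function of `℘(z)` for a complex multiplication `α`). [Cox2013]
* D. F. Lawden, *Elliptic Functions and Applications*, Springer 1989, §9.8 (9.8.14). [Lawden1989]
* D. Masser, *Elliptic Functions and Transcendence*, LNM 437, Springer 1975, Ch. III Lemma 3.1.
  [Masser1975]
* J. V. Armitage, W. F. Eberlein, *Elliptic Functions*, CUP 2006, §7.4.2 (addition theorems for
  `℘`, `ζ`). [ArmitageEberlein2001]
* J. H. Silverman, *The Arithmetic of Elliptic Curves*, 2nd ed., GTM 106, 2009, III.4–III.5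
  (isogenies, the invariant differential). [SilvermanAEC2009]
-/

noncomputable section

open scoped BigOperators
open scoped PeriodPair
open scoped Topology
open MvPolynomial Set Complex Filter

namespace Literature.NumberTheory.Transcendental

namespace CurvePeriods

set_option quotPrecheck false in
/-- Membership in the `ℚ̄`-span of the elementary relations, in the format of the conclusion of
`HuberWustholzCurvePeriods`. -/
local notation "InSpan" c:max => ∃ (k : ℕ) (ρ : Fin k → (PeriodSymbol →₀ ℂ)) (a : Fin k → ℂ),
  (∀ l, IsElementaryRelation (ρ l)) ∧ (∀ l, IsAlgebraic ℚ (a l)) ∧ c = ∑ l, a l • ρ l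

namespace Ell

variable (L : PeriodPair) (α : ℂ) (S : Finset ℂ)

/-! ### Complex multiplications and representatives of their kernels -/

/-- **Kernel data of a complex multiplication**: `α ≠ 0` with `αΛ ⊆ Λ`, and a finite system of
representatives `S ∋ 0` of `α⁻¹Λ/Λ` (`αx ∈ Λ ↔ x ≡ c (mod Λ)` for some `c ∈ S`, the `c ∈ S`
pairwise incongruent) — the kernel of `[α] : E_L → E_L` is `{φ(c) | c ∈ S}`. Such `S` exists
(`PeriodPair.exists_reps_of_mul_mem`). [cite: Cox2013, §10.B Thm. 10.14 (proof)] -/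
structure CMReps : Prop where
  /-- `α ≠ 0`. -/
  ne_zero : α ≠ 0
  /-- `αΛ ⊆ Λ`. -/
  mul_mem : ∀ l ∈ L.lattice, α * l ∈ L.lattice
  /-- `0 ∈ S`. -/
  zero_mem : (0 : ℂ) ∈ S
  /-- `S` represents `α⁻¹Λ/Λ`. -/
  reps : ∀ x, α * x ∈ L.lattice ↔ ∃ c ∈ S, x - c ∈ L.lattice
  /-- The representatives are pairwise incongruent. -/
  distinct : ∀ c ∈ S, ∀ c' ∈ S, c - c' ∈ L.lattice → c = c'

/-- Kernel data exist for every complex multiplication `α ≠ 0`, `αΛ ⊆ Λ`. [folklore] -/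
theorem exists_cmReps {L : PeriodPair} {α : ℂ} (hα0 : α ≠ 0)
    (hα : ∀ l ∈ L.lattice, α * l ∈ L.lattice) : ∃ S : Finset ℂ, CMReps L α S := by
  obtain ⟨S, hS0, hS, hSd⟩ := L.exists_reps_of_mul_mem hα0 hα
  exact ⟨S, ⟨hα0, hα, hS0, hS, hSd⟩⟩

namespace CMReps

variable {L α S} (hR : CMReps L α S)
include hR

/-- For `c ∈ S ∖ 0`: `αc ∈ Λ`. [folklore] -/
theorem mul_rep_mem {c : ℂ} (hc : c ∈ S.erase 0) : α * c ∈ L.lattice :=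
  (hR.reps c).2 ⟨c, Finset.mem_of_mem_erase hc, by simp⟩

/-- For `c ∈ S ∖ 0`: `c ∉ Λ`. [folklore] -/
theorem rep_notMem {c : ℂ} (hc : c ∈ S.erase 0) : c ∉ L.lattice := fun h =>
  (Finset.ne_of_mem_erase hc) (hR.distinct c (Finset.mem_of_mem_erase hc) 0 hR.zero_mem
    (by simpa using h))

/-- If `αz ∉ Λ` then `z ∉ Λ`. [folklore] -/
theorem notMem_of_mul_notMem {z : ℂ} (hz : α * z ∉ L.lattice) : z ∉ L.lattice :=
  fun h => hz (hR.mul_mem z h)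

/-- If `αz ∉ Λ` and `c ∈ S ∖ 0`: `z − c, z + c ∉ Λ` and `℘(z) ≠ ℘(c)`. [folklore] -/
theorem ne_of_mul_notMem {z c : ℂ} (hz : α * z ∉ L.lattice) (hc : c ∈ S.erase 0) :
    z - c ∉ L.lattice ∧ z + c ∉ L.lattice ∧ ℘[L] z ≠ ℘[L] c :=
  (PeriodPair.weierstrassP_ne_of_mul_notMem (L := L) hR.mul_mem hz (hR.mul_rep_mem hc)
    (hR.rep_notMem hc)).2

/-- Conversely: if `z ∉ Λ` and `℘(z) ≠ ℘(c)` for all `c ∈ S ∖ 0`, then `αz ∉ Λ`. [folklore] -/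
theorem mul_notMem_of_ne {z : ℂ} (hz : z ∉ L.lattice) (hne : ∀ c ∈ S.erase 0, ℘[L] z ≠ ℘[L] c) :
    α * z ∉ L.lattice := by
  intro h
  obtain ⟨c, hcS, hzc⟩ := (hR.reps z).1 h
  have hc0 : c ≠ 0 := by
    rintro rfl
    exact hz (by simpa using hzc)
  have hc : c ∈ S.erase 0 := Finset.mem_erase.2 ⟨hc0, hcS⟩
  refine hne c hc ?_
  have e : z = c + (z - c) := by ring
  rw [e]
  exact L.weierstrassP_add_coe c ⟨z - c, hzc⟩

/-- `[Λ : αΛ] ≠ 0` kills every representative: `N · c ∈ Λ`, so the `c ∈ S ∖ 0` are torsion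
points outside `Λ` and `φ(c)` is an algebraic point (for `g₂, g₃ ∈ ℚ̄`). [folklore] -/
theorem isAlgPt_rep (h₂ : IsAlgebraic ℚ L.g₂) (h₃ : IsAlgebraic ℚ L.g₃) {c : ℂ}
    (hc : c ∈ S.erase 0) : IsAlgPt L c := by
  have hN := L.natCard_mul_mem_lattice_of_mul_mem hR.mul_mem hR.ne_zero (hR.mul_rep_mem hc)
  have hN0 := L.natCard_quotient_range_mulLeft_ne_zero hR.mul_mem hR.ne_zero
  exact isAlgPt_of_torsion L h₂ h₃ (hR.rep_notMem hc) (Nat.pos_of_ne_zero hN0) hN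

/-- **A complex multiplication is an algebraic number** (a root of `X² − (a + d)X + (ad − bc)`
where `αω₁ = aω₁ + bω₂`, `αω₂ = cω₁ + dω₂`). [cite: Cox2013, §10.B Thm. 10.14 (proof)] -/
theorem isAlgebraic : IsAlgebraic ℚ α := by
  obtain ⟨a, b, hab⟩ := PeriodPair.mem_lattice.mp (hR.mul_mem _ L.ω₁_mem_lattice)
  obtain ⟨c, d, hcd⟩ := PeriodPair.mem_lattice.mp (hR.mul_mem _ L.ω₂_mem_lattice)
  have hquad := PeriodPair.sq_sub_trace_mul_add_det_eq_zero hab.symm hcd.symm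
  refine ⟨Polynomial.C 1 * Polynomial.X ^ 2 + Polynomial.C (-((a : ℚ) + d)) * Polynomial.X +
    Polynomial.C ((a : ℚ) * d - b * c), fun h0 => ?_, ?_⟩
  · have hdeg := Polynomial.degree_quadratic (b := -((a : ℚ) + d))
      (c := (a : ℚ) * d - b * c) (one_ne_zero (α := ℚ))
    rw [h0, Polynomial.degree_zero] at hdeg
    exact absurd hdeg (by decide)
  · simp only [map_add, map_mul, map_neg, Polynomial.aeval_X_pow, Polynomial.aeval_C,
      Polynomial.aeval_X, eq_ratCast]
    push_cast
    linear_combination hquad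

/-- `α⁻¹` is algebraic. [folklore] -/
theorem isAlgebraic_inv : IsAlgebraic ℚ α⁻¹ := hR.isAlgebraic.inv

end CMReps

/-! ### The kernel polynomial `Q = ∏_{c ∈ S ∖ 0} (x − ℘(c))²` and the curve `C_α ⊂ 𝔸³` -/

/-- `Q(℘(z)) = ∏_{c ∈ S ∖ 0} (℘(z) − ℘(c))²` as a function of `z`. [folklore] -/
def qfun (z : ℂ) : ℂ := ∏ c ∈ S.erase 0, (℘[L] z - ℘[L] c) ^ 2

/-- Its derivative `Σ_c (∏_{c' ≠ c} (℘(z) − ℘(c'))²) · 2(℘(z) − ℘(c))℘′(z)`. [folklore] -/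
def qfunD (z : ℂ) : ℂ :=
  ∑ c ∈ S.erase 0, (∏ c' ∈ (S.erase 0).erase c, (℘[L] z - ℘[L] c') ^ 2) *
    (2 * (℘[L] z - ℘[L] c) * ℘'[L] z)

/-- The factor `(x − ℘(c))²` as a polynomial on `𝔸³`. [folklore] -/
def Dc (c : ℂ) : MvPolynomial (Fin 3) ℂ := (X 0 - C (℘[L] c)) ^ 2

/-- **The kernel polynomial** `Q = ∏_{c ∈ S ∖ 0} (x − ℘(c))²` on `𝔸³`. [cite: Cox2013, §10.B Thm. 10.14 (proof)] -/
def QC : MvPolynomial (Fin 3) ℂ := ∏ c ∈ S.erase 0, Dc L c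

/-- `Q(p) = ∏_c (p₀ − ℘(c))²`. [folklore] -/
theorem eval_QC (p : Fin 3 → ℂ) : eval p (QC L S) = ∏ c ∈ S.erase 0, (p 0 - ℘[L] c) ^ 2 := by
  simp [QC, Dc, map_prod]

/-- `Q` does not involve `y`: `∂Q/∂y = 0`. [folklore] -/
theorem pderiv_one_QC : pderiv 1 (QC L S) = 0 := by
  classical
  unfold QC
  refine Finset.prod_induction _ (fun q : MvPolynomial (Fin 3) ℂ => pderiv 1 q = 0)
    (fun a b ha hb => by rw [Derivation.leibniz, ha, hb, smul_zero, smul_zero, add_zero]) ?_ ?_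
  · exact Derivation.map_one_eq_zero _
  · intro c _
    simp [Dc, Derivation.leibniz_pow, pderiv_X]

/-- `Q` does not involve `w`: `∂Q/∂w = 0`. [folklore] -/
theorem pderiv_two_QC : pderiv 2 (QC L S) = 0 := by
  classical
  unfold QC
  refine Finset.prod_induction _ (fun q : MvPolynomial (Fin 3) ℂ => pderiv 2 q = 0)
    (fun a b ha hb => by rw [Derivation.leibniz, ha, hb, smul_zero, smul_zero, add_zero]) ?_ ?_
  · exact Derivation.map_one_eq_zero _
  · intro c _
    simp [Dc, Derivation.leibniz_pow, pderiv_X]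

/-- **The affine curve `C_α = {(x, y, w) | y² = x³ + Ax + B, w·Q(x) = 1} ⊂ 𝔸³`** — `E_L` minus the
kernel of `[α]` (the points `φ(c)`, `c ∈ S`, i.e. `O` and the points with `Q(x) = 0`); the
domain of the multiplication-by-`α` map as a polynomial map. [folklore] -/
abbrev curveC : CurveData := ⟨3, 2, ![X 1 ^ 2 - fPoly3 L, X 2 * QC L S - 1]⟩

/-- `q ∈ C_α ↔ q₁² = f(q₀) ∧ q₂ Q(q₀) = 1`. [folklore] -/
theorem mem_points_curveC_iff (q : Fin 3 → ℂ) :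
    q ∈ (curveC L S).points ↔
      q 1 ^ 2 = q 0 ^ 3 + A L * q 0 + B L ∧ q 2 * (∏ c ∈ S.erase 0, (q 0 - ℘[L] c) ^ 2) = 1 := by
  rw [CurveData.mem_points]
  rw [show (∀ j : Fin (curveC L S).m, eval q ((curveC L S).F j) = 0) ↔
      eval q ((curveC L S).F 0) = 0 ∧ eval q ((curveC L S).F 1) = 0 from Fin.forall_fin_two]
  simp [eval_fPoly3, sub_eq_zero, eval_QC]

/-- The gradient of `y² − f`: `(−(3x² + A), 2y, 0)`. [folklore] -/
theorem gradient_curveC_zero (q : Fin 3 → ℂ) :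
    (curveC L S).gradient 0 q = ![-(3 * q 0 ^ 2 + A L), 2 * q 1, 0] := by
  funext k
  simp only [CurveData.gradient, Matrix.cons_val_zero, map_sub, Derivation.leibniz_pow,
    pderiv_fPoly3]
  fin_cases k <;> simp

/-- The gradient of `w Q(x) − 1`: `(w ∂Q/∂x, 0, Q(x))`. [folklore] -/
theorem gradient_curveC_one (q : Fin 3 → ℂ) :
    (curveC L S).gradient 1 q =
      ![q 2 * eval q (pderiv 0 (QC L S)), 0, ∏ c ∈ S.erase 0, (q 0 - ℘[L] c) ^ 2] := by
  funext k
  simp only [CurveData.gradient, Matrix.cons_val_one]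
  fin_cases k
  · simp [Derivation.leibniz, pderiv_X]
  · simp [Derivation.leibniz, pderiv_X, pderiv_one_QC]
  · simp [Derivation.leibniz, pderiv_X, pderiv_two_QC, eval_QC]

/-! ### The parametrisation `ψ(z) = (℘(z), ℘′(z)/2, Q(℘(z))⁻¹)` of `C_α` -/

/-- `ψ(z) = (℘(z), ℘′(z)/2, Q(℘(z))⁻¹)`. [folklore] -/
def psiC (z : ℂ) : Fin 3 → ℂ := ![℘[L] z, ℘'[L] z / 2, (qfun L S z)⁻¹]

/-- `ψ′(z) = (℘′, 3℘² − g₂/4, −Q(℘)′/Q(℘)²)`. [folklore] -/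
def psiCD (z : ℂ) : Fin 3 → ℂ :=
  ![℘'[L] z, 3 * ℘[L] z ^ 2 - L.g₂ / 4, -qfunD L S z / qfun L S z ^ 2]

/-- [folklore] -/
@[simp] theorem psiC_apply_zero (z : ℂ) : psiC L S z 0 = ℘[L] z := rfl

/-- [folklore] -/
@[simp] theorem psiC_apply_one (z : ℂ) : psiC L S z 1 = ℘'[L] z / 2 := rfl

/-- [folklore] -/
@[simp] theorem psiC_apply_two (z : ℂ) : psiC L S z 2 = (qfun L S z)⁻¹ := rfl

/-- [folklore] -/
@[simp] theorem psiCD_apply_zero (z : ℂ) : psiCD L S z 0 = ℘'[L] z := rfl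

/-- [folklore] -/
@[simp] theorem psiCD_apply_one (z : ℂ) : psiCD L S z 1 = 3 * ℘[L] z ^ 2 - L.g₂ / 4 := rfl

/-- [folklore] -/
@[simp] theorem psiCD_apply_two (z : ℂ) : psiCD L S z 2 = -qfunD L S z / qfun L S z ^ 2 := rfl

/-- `ι(ψ(z)) = φ(z)` (first two coordinates). [folklore] -/
theorem psiC_phi (z : ℂ) : ![psiC L S z 0, psiC L S z 1] = phi L z := rfl

/-- `Q(ψ(z)) = Q(℘(z))`. [folklore] -/
theorem eval_QC_psiC (z : ℂ) : eval (psiC L S z) (QC L S) = qfun L S z := by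
  rw [eval_QC]; rfl

variable {L α S}

/-- `Q(℘(z)) ≠ 0` when `αz ∉ Λ`. [folklore] -/
theorem CMReps.qfun_ne_zero (hR : CMReps L α S) {z : ℂ} (hz : α * z ∉ L.lattice) :
    qfun L S z ≠ 0 := by
  rw [qfun, Finset.prod_ne_zero_iff]
  exact fun c hc => pow_ne_zero 2 (sub_ne_zero.2 (hR.ne_of_mul_notMem hz hc).2.2)

/-- Conversely `z ∉ Λ`, `Q(℘(z)) ≠ 0` force `αz ∉ Λ`. [folklore] -/
theorem CMReps.mul_notMem_of_qfun_ne_zero (hR : CMReps L α S) {z : ℂ} (hz : z ∉ L.lattice)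
    (hq : qfun L S z ≠ 0) : α * z ∉ L.lattice := by
  refine hR.mul_notMem_of_ne hz fun c hc h => hq ?_
  rw [qfun]
  exact Finset.prod_eq_zero hc (by rw [h, sub_self, zero_pow two_ne_zero])

variable (L S) in
/-- `ψ(z) ∈ C_α` for `z ∉ Λ` with `Q(℘(z)) ≠ 0`. [folklore] -/
theorem psiC_mem_points {z : ℂ} (hz : z ∉ L.lattice) (hq : qfun L S z ≠ 0) :
    psiC L S z ∈ (curveC L S).points := by
  rw [mem_points_curveC_iff]
  refine ⟨?_, ?_⟩
  · have h := (Weier.mem_points_iff (A L) (B L) (phi L z)).1 (phi_mem_points L hz)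
    rw [Weier.eval_fPoly] at h
    simpa using h
  · simp only [psiC_apply_two, psiC_apply_zero]
    exact inv_mul_cancel₀ hq

variable (L S) in
/-- `Q(℘(z))` has derivative `qfunD z`. [folklore] -/
theorem hasDerivAt_qfun {z : ℂ} (hz : z ∉ L.lattice) : HasDerivAt (qfun L S) (qfunD L S z) z := by
  classical
  have h℘ := PeriodPair.hasDerivAt_weierstrassP (L := L) hz
  have hf : ∀ c ∈ S.erase 0, HasDerivAt (fun w => (℘[L] w - ℘[L] c) ^ 2)
      (2 * (℘[L] z - ℘[L] c) * ℘'[L] z) z := fun c _ => by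
    have h := (h℘.sub_const (℘[L] c)).fun_pow 2
    simpa [pow_one] using h
  have h := HasDerivAt.fun_finsetProd hf
  simp only [smul_eq_mul] at h
  exact h

variable (L S) in
/-- `ψ` has complex derivative `ψ′` off `Λ ∪ {Q(℘) = 0}`. [folklore] -/
theorem hasDerivAt_psiC {z : ℂ} (hz : z ∉ L.lattice) (hq : qfun L S z ≠ 0) :
    ∀ k : Fin 3, HasDerivAt (fun w => psiC L S w k) (psiCD L S z k) z := by
  have h0 := hasDerivAt_phi L hz 0
  have h1 := hasDerivAt_phi L hz 1
  simp only [phi_apply_zero, phiD_apply_zero, phi_apply_one, phiD_apply_one] at h0 h1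
  intro k
  fin_cases k
  · exact h0
  · exact h1
  · show HasDerivAt (fun w => (qfun L S w)⁻¹) (-qfunD L S z / qfun L S z ^ 2) z
    exact (hasDerivAt_qfun L S hz).inv hq

variable (L S) in
/-- Along a real shift: `s ↦ ψ(z₀ + s)` has derivative `ψ′(z₀ + t)` at `t`. [folklore] -/
theorem hasDerivAt_psiC_shift (z₀ : ℂ) {t : ℝ} (h : z₀ + t ∉ L.lattice)
    (hq : qfun L S (z₀ + t) ≠ 0) (k : Fin 3) :
    HasDerivAt (fun s : ℝ => psiC L S (z₀ + s) k) (psiCD L S (z₀ + t) k) t :=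
  (HasDerivAt.comp_const_add z₀ (t : ℂ) (hasDerivAt_psiC L S h hq k)).comp_ofReal

variable (L S) in
/-- `Q(℘(z₀ + t)) ≠ 0` for small real `t` if `Q(℘(z₀)) ≠ 0`. [folklore] -/
theorem eventually_shift_qfun_ne_zero {z₀ : ℂ} (hz₀ : z₀ ∉ L.lattice) (hq : qfun L S z₀ ≠ 0) :
    ∀ᶠ t : ℝ in 𝓝 0, qfun L S (z₀ + (t : ℂ)) ≠ 0 := by
  have hc : ContinuousAt (fun t : ℝ => qfun L S (z₀ + (t : ℂ))) 0 := by
    have hd : ContinuousAt (qfun L S) z₀ := (hasDerivAt_qfun L S hz₀).continuousAt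
    exact hd.comp_of_eq (by fun_prop : Continuous fun t : ℝ => z₀ + (t : ℂ)).continuousAt (by simp)
  exact hc.eventually_ne (by simpa using hq)

/-- `ψ′(z)` is tangent to `C_α` at `ψ(z)`: differentiate the equations along `t ↦ ψ(z + t)`.
[folklore] -/
theorem psiCD_mem_tangentSpace {z : ℂ} (hz : z ∉ L.lattice) (hq : qfun L S z ≠ 0) :
    psiCD L S z ∈ (curveC L S).tangentSpace (psiC L S z) := by
  intro j
  -- `F_j(ψ(z + t)) = 0` near `t = 0`, so its derivative `∇F_j(ψ(z)) · ψ′(z)` vanishes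
  have hD := hasDerivAt_eval_comp (γ := fun t : ℝ => psiC L S (z + t)) (γ' := psiCD L S z)
    (t := 0) (fun i => by
      have h := hasDerivAt_psiC_shift L S z (t := 0) (by simpa using hz) (by simpa using hq) i
      simpa using h) ((curveC L S).F j)
  have hE : (fun t : ℝ => eval (psiC L S (z + t)) ((curveC L S).F j)) =ᶠ[𝓝 0] fun _ => 0 := by
    filter_upwards [eventually_shift_notMem L hz, eventually_shift_qfun_ne_zero L S hz hq]
      with t ht1 ht2
    exact (psiC_mem_points L S ht1 ht2) j
  have h0 : HasDerivAt (fun t : ℝ => eval (psiC L S (z + t)) ((curveC L S).F j)) 0 0 :=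
    (hasDerivAt_const (0 : ℝ) (0 : ℂ)).congr_of_eventuallyEq hE
  have h := hD.unique h0
  simpa [CurveData.gradient] using h

/-- **`ψ` parametrises `C_α`**: every point of `C_α` is `ψ(z)` with `z ∉ Λ`, `Q(℘(z)) ≠ 0`.
[folklore] -/
theorem exists_psiC_eq {q : Fin 3 → ℂ} (hq : q ∈ (curveC L S).points) :
    ∃ z, z ∉ L.lattice ∧ qfun L S z ≠ 0 ∧ psiC L S z = q := by
  rw [mem_points_curveC_iff] at hq
  obtain ⟨hcub, hw⟩ := hq
  have hQ : (∏ c ∈ S.erase 0, (q 0 - ℘[L] c) ^ 2) ≠ 0 := fun h => by simp [h] at hw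
  obtain ⟨z, hz, hxz⟩ := L.exists_weierstrassP_eq (q 0)
  have hqz : qfun L S z = ∏ c ∈ S.erase 0, (q 0 - ℘[L] c) ^ 2 := by rw [qfun, hxz]
  have hqz0 : qfun L S z ≠ 0 := by rwa [hqz]
  have hsq : (℘'[L] z / 2) ^ 2 = q 1 ^ 2 := by
    rw [hcub, ← hxz]
    have h := L.derivWeierstrassP_sq z hz
    simp only [A, B]
    linear_combination (1 / 4 : ℂ) * h
  have hw' : q 2 = (qfun L S z)⁻¹ := by rw [hqz]; exact eq_inv_of_mul_eq_one_left hw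
  rcases sq_eq_sq_iff_eq_or_eq_neg.1 hsq with h | h
  · refine ⟨z, hz, hqz0, ?_⟩
    funext k
    fin_cases k
    · simpa using hxz
    · simpa using h
    · simp [hw']
  · have hz' : -z ∉ L.lattice := fun h' => hz (by simpa using neg_mem h')
    have hqn : qfun L S (-z) = qfun L S z := by simp [qfun, L.weierstrassP_neg]
    refine ⟨-z, hz', by rwa [hqn], ?_⟩
    funext k
    fin_cases k
    · simpa [L.weierstrassP_neg] using hxz
    · simp [L.derivWeierstrassP_neg, neg_div, h]
    · simp [hqn, hw']

variable (L S) in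
/-- For `z₀ ∉ Λ` with `Q(℘(z₀)) ≠ 0`, the points `ψ(z₀ + t)`, `t ≠ 0` small, differ from `ψ(z₀)`
and lie on `C_α`: no point of `C_α` is isolated. [folklore] -/
theorem psiC_mem_closure {z₀ : ℂ} (hz₀ : z₀ ∉ L.lattice) (hq : qfun L S z₀ ≠ 0) :
    psiC L S z₀ ∈ closure ((curveC L S).points \ {psiC L S z₀}) := by
  have hev1 := eventually_shift_notMem L hz₀
  have hev2 := eventually_shift_qfun_ne_zero L S hz₀ hq
  have hev3 : ∀ᶠ t : ℝ in 𝓝[≠] 0, psiC L S (z₀ + (t : ℂ)) ≠ psiC L S z₀ := by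
    by_cases h2 : ℘'[L] z₀ = 0
    · have hq' := psiC_mem_points L S hz₀ hq
      rw [mem_points_curveC_iff] at hq'
      have hf : 3 * ℘[L] z₀ ^ 2 + A L ≠ 0 :=
        fderiv_ne_zero_of_y_eq_zero L (q := psiC L S z₀) hq'.1 (by simp [h2])
      have hd : HasDerivAt (fun t : ℝ => ℘'[L] (z₀ + (t : ℂ)) / 2) (3 * ℘[L] z₀ ^ 2 - L.g₂ / 4) 0 := by
        have h := hasDerivAt_psiC_shift L S z₀ (t := 0) (by simpa using hz₀) (by simpa using hq) 1
        simpa using h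
      have hne' : 3 * ℘[L] z₀ ^ 2 - L.g₂ / 4 ≠ 0 := by
        have e : 3 * ℘[L] z₀ ^ 2 - L.g₂ / 4 = 3 * ℘[L] z₀ ^ 2 + A L := by rw [A]; ring
        rwa [e]
      filter_upwards [hd.eventually_ne hne'] with t ht h
      have h1 : ℘'[L] (z₀ + (t : ℂ)) / 2 = ℘'[L] z₀ / 2 := congrFun h 1
      apply ht
      show ℘'[L] (z₀ + (t : ℂ)) / 2 = ℘'[L] (z₀ + ((0 : ℝ) : ℂ)) / 2
      rw [h1, ofReal_zero, add_zero]
    · have hd : HasDerivAt (fun t : ℝ => ℘[L] (z₀ + (t : ℂ))) (℘'[L] z₀) 0 := by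
        have h := hasDerivAt_psiC_shift L S z₀ (t := 0) (by simpa using hz₀) (by simpa using hq) 0
        simpa using h
      filter_upwards [hd.eventually_ne h2] with t ht h
      have h0 : ℘[L] (z₀ + (t : ℂ)) = ℘[L] z₀ := congrFun h 0
      apply ht
      show ℘[L] (z₀ + (t : ℂ)) = ℘[L] (z₀ + ((0 : ℝ) : ℂ))
      rw [h0, ofReal_zero, add_zero]
  have hcont : Tendsto (fun t : ℝ => psiC L S (z₀ + (t : ℂ))) (𝓝 0) (𝓝 (psiC L S z₀)) := by
    rw [tendsto_pi_nhds]
    intro k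
    have h := (hasDerivAt_psiC_shift L S z₀ (t := 0) (by simpa using hz₀) (by simpa using hq)
      k).continuousAt.tendsto
    simpa using h
  refine mem_closure_of_tendsto (b := 𝓝[≠] (0 : ℝ)) (f := fun t : ℝ => psiC L S (z₀ + (t : ℂ)))
    (hcont.mono_left nhdsWithin_le_nhds) ?_
  filter_upwards [mem_nhdsWithin_of_mem_nhds hev1, mem_nhdsWithin_of_mem_nhds hev2, hev3]
    with t ht1 ht2 ht3
  exact ⟨psiC_mem_points L S ht1 ht2, ht3⟩

/-- `D_c = (x − ℘(c))²` is over `ℚ̄` for `c ∈ S ∖ 0` (a division value). [folklore] -/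
theorem CMReps.hasAlgCoeffs_Dc (hR : CMReps L α S) (h₂ : IsAlgebraic ℚ L.g₂)
    (h₃ : IsAlgebraic ℚ L.g₃) {c : ℂ} (hc : c ∈ S.erase 0) : HasAlgCoeffs (Dc L c) := by
  unfold Dc
  exact ((hasAlgCoeffs_X 0).sub (hasAlgCoeffs_C (hR.isAlgPt_rep h₂ h₃ hc).weierstrassP)).pow 2

/-- `Q` is over `ℚ̄`. [folklore] -/
theorem CMReps.hasAlgCoeffs_QC (hR : CMReps L α S) (h₂ : IsAlgebraic ℚ L.g₂)
    (h₃ : IsAlgebraic ℚ L.g₃) : HasAlgCoeffs (QC L S) := by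
  unfold QC
  exact hasAlgCoeffs_finsetProd _ (fun c => Dc L c) fun c hc => hR.hasAlgCoeffs_Dc h₂ h₃ hc

/-- **`C_α` is a smooth affine curve over `ℚ̄`** (for `g₂, g₃ ∈ ℚ̄`): the two gradients
`(−f′, 2y, 0)`, `(w Q′, 0, Q)` are independent at every point (`Q(x) ≠ 0` on `C_α`, and
`(f′, y) ≠ 0` on a smooth Weierstrass curve), and no point is isolated. [folklore] -/
theorem CMReps.smoothC (hR : CMReps L α S) (h₂ : IsAlgebraic ℚ L.g₂) (h₃ : IsAlgebraic ℚ L.g₃) :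
    (curveC L S).IsSmoothAffineCurve where
  algebraic j := by
    fin_cases j
    · simpa using ((hasAlgCoeffs_X (n := 3) 1).pow 2).sub (hasAlgCoeffs_fPoly3 L h₂ h₃)
    · simpa using ((hasAlgCoeffs_X (n := 3) 2).mul (hR.hasAlgCoeffs_QC h₂ h₃)).sub hasAlgCoeffs_one
  rank_eq q hq := by
    have hq' := hq
    rw [mem_points_curveC_iff] at hq
    obtain ⟨hcub, hw⟩ := hq
    have hx : (∏ c ∈ S.erase 0, (q 0 - ℘[L] c) ^ 2) ≠ 0 := fun h => by simp [h] at hw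
    have hfun : (fun j => (curveC L S).gradient j q) =
        ![![-(3 * q 0 ^ 2 + A L), 2 * q 1, 0],
          ![q 2 * eval q (pderiv 0 (QC L S)), 0, ∏ c ∈ S.erase 0, (q 0 - ℘[L] c) ^ 2]] := by
      funext j
      fin_cases j
      · simpa using gradient_curveC_zero L S q
      · simpa using gradient_curveC_one L S q
    have hli : LinearIndependent ℂ
        ![![-(3 * q 0 ^ 2 + A L), 2 * q 1, 0],
          ![q 2 * eval q (pderiv 0 (QC L S)), 0, ∏ c ∈ S.erase 0, (q 0 - ℘[L] c) ^ 2]] := by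
      rw [LinearIndependent.pair_iff]
      intro s t hst
      have h2 := congrFun hst 2
      have h1 := congrFun hst 1
      have h0 := congrFun hst 0
      simp only [Pi.add_apply, Pi.smul_apply, Matrix.cons_val_zero, Matrix.cons_val_one,
        Matrix.head_cons, smul_eq_mul, mul_zero, zero_add, add_zero, Pi.zero_apply,
        Matrix.cons_val_two, Matrix.tail_cons] at h0 h1 h2
      have ht : t = 0 := (mul_eq_zero.mp h2).resolve_right hx
      rw [ht, zero_mul, add_zero] at h0
      have hs : s = 0 := by
        by_contra hs
        have hy : q 1 = 0 := by
          rcases mul_eq_zero.mp h1 with h | h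
          · exact absurd h hs
          · exact (mul_eq_zero.mp h).resolve_left two_ne_zero
        have hf := fderiv_ne_zero_of_y_eq_zero L hcub hy
        rcases mul_eq_zero.mp h0 with h | h
        · exact hs h
        · exact hf (neg_eq_zero.mp h)
      exact ⟨hs, ht⟩
    rw [hfun, finrank_span_eq_card hli]
    rfl
  not_isolated q hq := by
    obtain ⟨z₀, hz₀, hq0, rfl⟩ := exists_psiC_eq hq
    exact psiC_mem_closure L S hz₀ hq0

/-! ### The tangent line of `C_α` at `ψ(z)` is spanned by `ψ′(z)` -/

/-- At `ψ(z)` every tangent vector of `C_α` is a multiple of `ψ′(z)`. [folklore] -/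
theorem exists_eq_smul_psiCD (hE : (curveC L S).IsSmoothAffineCurve) {z : ℂ} (hz : z ∉ L.lattice)
    (hq : qfun L S z ≠ 0) {t : Fin 3 → ℂ} (ht : t ∈ (curveC L S).tangentSpace (psiC L S z)) :
    ∃ c : ℂ, t = c • psiCD L S z := by
  have hpar := tangent_parallel hE (psiC_mem_points L S hz hq) ht (psiCD_mem_tangentSpace hz hq)
  by_cases h2 : ℘'[L] z = 0
  · have hq' := psiC_mem_points L S hz hq
    rw [mem_points_curveC_iff] at hq'
    have hf : 3 * ℘[L] z ^ 2 + A L ≠ 0 :=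
      fderiv_ne_zero_of_y_eq_zero L (q := psiC L S z) hq'.1 (by simp [h2])
    have hne1 : psiCD L S z 1 ≠ 0 := by
      rw [psiCD_apply_one]
      have e : 3 * ℘[L] z ^ 2 - L.g₂ / 4 = 3 * ℘[L] z ^ 2 + A L := by rw [A]; ring
      rwa [e]
    refine ⟨t 1 / psiCD L S z 1, funext fun j => ?_⟩
    have h := hpar 1 j
    simp only [Pi.smul_apply, smul_eq_mul]
    field_simp
    linear_combination h
  · have hne0 : psiCD L S z 0 ≠ 0 := by rwa [psiCD_apply_zero]
    refine ⟨t 0 / psiCD L S z 0, funext fun j => ?_⟩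
    have h := hpar 0 j
    simp only [Pi.smul_apply, smul_eq_mul]
    field_simp
    linear_combination h

/-- **A form vanishes on `C_α` as soon as it kills `ψ′(z)` at every `ψ(z)`.** [folklore] -/
theorem vanishesOn_curveC_of_psi (hE : (curveC L S).IsSmoothAffineCurve)
    (ν : Fin 3 → MvPolynomial (Fin 3) ℂ)
    (h : ∀ z, z ∉ L.lattice → qfun L S z ≠ 0 →
      ∑ i, eval (psiC L S z) (ν i) * psiCD L S z i = 0) :
    VanishesOn (curveC L S) ν := by
  intro q hq t ht
  obtain ⟨z, hz, hqz, rfl⟩ := exists_psiC_eq hq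
  obtain ⟨c, rfl⟩ := exists_eq_smul_psiCD hE hz hqz ht
  simp only [Pi.smul_apply, smul_eq_mul]
  have e : ∑ i, eval (psiC L S z) (ν i) * (c * psiCD L S z i) =
      c * ∑ i, eval (psiC L S z) (ν i) * psiCD L S z i := by
    rw [Finset.mul_sum]
    refine Finset.sum_congr rfl fun i _ => ?_
    ring
  rw [e, h z hz hqz, mul_zero]

/-- The derivative of a polynomial along `t ↦ ψ(z + t)` at `t = 0`. [folklore] -/
theorem hasDerivAt_eval_psiC_shift {z : ℂ} (hz : z ∉ L.lattice) (hq : qfun L S z ≠ 0)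
    (P : MvPolynomial (Fin 3) ℂ) :
    HasDerivAt (fun t : ℝ => eval (psiC L S (z + t)) P)
      (∑ i, eval (psiC L S z) (pderiv i P) * psiCD L S z i) 0 := by
  have h := hasDerivAt_eval_comp (γ := fun t : ℝ => psiC L S (z + t)) (γ' := psiCD L S z) (t := 0)
    (fun i => by
      have h := hasDerivAt_psiC_shift L S z (t := 0) (by simpa using hz) (by simpa using hq) i
      simpa using h) P
  simpa using h

/-! ### The transformation polynomials: `℘(αz) = P(℘(z))/Q(℘(z))` -/

variable (L α S)

/-- `K = Σ_{c ∈ S ∖ 0} ℘(c)`. [cite: Cox2013, §10.B Thm. 10.14 (proof)] -/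
def KC : ℂ := ∑ c ∈ S.erase 0, ℘[L] c

/-- The numerators `N_c = 2e_c x² + (2e_c² − g₂/2)x − (g₂e_c/2 + g₃)` of
`℘(z + c) + ℘(z − c) = N_c(℘ z)/(℘ z − e_c)²`, `e_c = ℘(c)`. [cite: WhittakerWatson1927, Example 20.3.3] -/
def Nc (c : ℂ) : MvPolynomial (Fin 3) ℂ :=
  C (2 * ℘[L] c) * X 0 ^ 2 + C (2 * ℘[L] c ^ 2 - L.g₂ / 2) * X 0 - C (L.g₂ * ℘[L] c / 2 + L.g₃)

/-- **The transformation polynomial `P`**: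
`2α² P = 2xQ + Σ_{c ≠ 0} N_c ∏_{c' ≠ c, 0} D_{c'} − 2KQ`, so that `℘(αz) = P(℘ z)/Q(℘ z)`.
[cite: Cox2013, §10.B Thm. 10.14 (proof, (ii) ⇒ (iii))] -/
def PC : MvPolynomial (Fin 3) ℂ :=
  C (α ^ 2)⁻¹ * (X 0 * QC L S +
    C (1 / 2 : ℂ) * (∑ c ∈ S.erase 0, Nc L c * ∏ c' ∈ (S.erase 0).erase c, Dc L c') -
      C (KC L S) * QC L S)

variable {L α S}

/-- `K ∈ ℚ̄`. [folklore] -/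
theorem CMReps.isAlgebraic_KC (hR : CMReps L α S) (h₂ : IsAlgebraic ℚ L.g₂)
    (h₃ : IsAlgebraic ℚ L.g₃) : IsAlgebraic ℚ (KC L S) := by
  rw [KC]
  exact isAlgebraic_finsetSum _ _ fun c hc => (hR.isAlgPt_rep h₂ h₃ hc).weierstrassP

/-- `N_c` is over `ℚ̄`. [folklore] -/
theorem CMReps.hasAlgCoeffs_Nc (hR : CMReps L α S) (h₂ : IsAlgebraic ℚ L.g₂)
    (h₃ : IsAlgebraic ℚ L.g₃) {c : ℂ} (hc : c ∈ S.erase 0) : HasAlgCoeffs (Nc L c) := by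
  have he := (hR.isAlgPt_rep h₂ h₃ hc).weierstrassP
  have h2 : IsAlgebraic ℚ (2 : ℂ) := isAlgebraic_nat 2
  refine (((hasAlgCoeffs_C (h2.mul he)).mul ((hasAlgCoeffs_X 0).pow 2)).add
    ((hasAlgCoeffs_C ?_).mul (hasAlgCoeffs_X 0))).sub (hasAlgCoeffs_C ?_)
  · exact (h2.mul (he.pow 2)).sub (h₂.mul h2.inv)
  · exact ((h₂.mul he).mul h2.inv).add h₃

/-- `P` is over `ℚ̄`. [folklore] -/
theorem CMReps.hasAlgCoeffs_PC (hR : CMReps L α S) (h₂ : IsAlgebraic ℚ L.g₂)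
    (h₃ : IsAlgebraic ℚ L.g₃) : HasAlgCoeffs (PC L α S) := by
  have hQ := hR.hasAlgCoeffs_QC h₂ h₃
  refine (hasAlgCoeffs_C (hR.isAlgebraic.pow 2).inv).mul ((((hasAlgCoeffs_X 0).mul hQ).add
    ((hasAlgCoeffs_C ?_).mul (hasAlgCoeffs_finsetSum _ _ fun c hc => ?_))).sub
    ((hasAlgCoeffs_C (hR.isAlgebraic_KC h₂ h₃)).mul hQ))
  · rw [one_div]; exact (isAlgebraic_nat 2).inv
  · exact (hR.hasAlgCoeffs_Nc h₂ h₃ hc).mul (hasAlgCoeffs_finsetProd _ (fun c' => Dc L c')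
      fun c' hc' => hR.hasAlgCoeffs_Dc h₂ h₃ (Finset.mem_of_mem_erase hc'))

/-- **`P(ψ(z)) = Q(℘(z)) · ℘(αz)`** for `αz ∉ Λ` — the transformation formula
`α²℘(αz) = Σ_{c ∈ S} ℘(z − c) − Σ_{c ≠ 0} ℘(c)` (`PeriodPair.weierstrassP_mul_eq_sum_sub`),
symmetrised (`PeriodPair.sum_weierstrassP_add_eq`) and written in `℘(z)` by
`℘(z + c) + ℘(z − c) = N_c(℘ z)/(℘ z − e_c)²`. (The computation of
`PeriodPair.exists_rationalMap_of_mul_mem`, repeated for the explicit polynomials.)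
[cite: Cox2013, §10.B Thm. 10.14 (proof, (ii) ⇒ (iii))] [cite: Lawden1989, §9.8 eq. (9.8.14)] -/
theorem CMReps.eval_PC_psiC (hR : CMReps L α S) {z : ℂ} (hz : α * z ∉ L.lattice) :
    eval (psiC L S z) (PC L α S) = qfun L S z * ℘[L] (α * z) := by
  classical
  have hα0 := hR.ne_zero
  set S' := S.erase 0 with hS'
  have hzΛ : z ∉ L.lattice := hR.notMem_of_mul_notMem hz
  have hne : ∀ c ∈ S', ℘[L] z - ℘[L] c ≠ 0 := fun c hc =>
    sub_ne_zero.2 (hR.ne_of_mul_notMem hz hc).2.2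
  have hDcz : ∀ c ∈ S', eval (psiC L S z) (Dc L c) ≠ 0 := fun c hc => by
    simp only [Dc, map_pow, map_sub, eval_X, eval_C, psiC_apply_zero]
    exact pow_ne_zero 2 (hne c hc)
  have hQz : eval (psiC L S z) (QC L S) = qfun L S z := eval_QC_psiC L S z
  have hQz0 : qfun L S z ≠ 0 := hR.qfun_ne_zero hz
  -- the symmetrised transformation formula
  have key : 2 * α ^ 2 * ℘[L] (α * z) =
      2 * ℘[L] z + ∑ c ∈ S', eval (psiC L S z) (Nc L c) / eval (psiC L S z) (Dc L c) -
        2 * KC L S := by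
    have h1 := PeriodPair.weierstrassP_mul_eq_sum_sub (L := L) hα0 hR.zero_mem hR.reps
      hR.distinct hz
    rw [← hS'] at h1
    have h2 := PeriodPair.sum_weierstrassP_add_eq (L := L) hα0 hR.zero_mem hR.reps hR.distinct hz
    have hsplit₁ : ∑ c ∈ S, ℘[L] (z - c) = ℘[L] z + ∑ c ∈ S', ℘[L] (z - c) := by
      rw [hS', ← Finset.add_sum_erase S _ hR.zero_mem, sub_zero]
    have hsplit₂ : ∑ c ∈ S, ℘[L] (z + c) = ℘[L] z + ∑ c ∈ S', ℘[L] (z + c) := by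
      rw [hS', ← Finset.add_sum_erase S _ hR.zero_mem, add_zero]
    have hsym : ∑ c ∈ S', eval (psiC L S z) (Nc L c) / eval (psiC L S z) (Dc L c) =
        ∑ c ∈ S', (℘[L] (z + c) + ℘[L] (z - c)) := by
      refine Finset.sum_congr rfl fun c hc => ?_
      obtain ⟨hzc, hzc', -⟩ := hR.ne_of_mul_notMem hz hc
      rw [L.weierstrassP_add_add_weierstrassP_sub hzΛ (hR.rep_notMem hc) hzc hzc']
      simp only [Nc, Dc, map_add, map_sub, map_mul, map_pow, eval_C, eval_X, psiC_apply_zero]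
    rw [hsym, Finset.sum_add_distrib, KC]
    linear_combination 2 * h1 + hsplit₁ - h2 + hsplit₂
  -- evaluate `P`
  have hfrac : ∀ c ∈ S', eval (psiC L S z) (Nc L c) *
      ∏ c' ∈ S'.erase c, eval (psiC L S z) (Dc L c') =
      eval (psiC L S z) (Nc L c) / eval (psiC L S z) (Dc L c) * qfun L S z := by
    intro c hc
    have hQc : qfun L S z =
        eval (psiC L S z) (Dc L c) * ∏ c' ∈ S'.erase c, eval (psiC L S z) (Dc L c') := by
      rw [← hQz, QC, map_prod, ← Finset.mul_prod_erase S' _ hc]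
    rw [hQc, ← mul_assoc, div_mul_cancel₀ _ (hDcz c hc)]
  have hsum : ∑ c ∈ S', eval (psiC L S z) (Nc L c) *
      ∏ c' ∈ S'.erase c, eval (psiC L S z) (Dc L c') =
      (∑ c ∈ S', eval (psiC L S z) (Nc L c) / eval (psiC L S z) (Dc L c)) * qfun L S z := by
    rw [Finset.sum_mul]
    exact Finset.sum_congr rfl hfrac
  have hPz : eval (psiC L S z) (PC L α S) = (α ^ 2)⁻¹ * ((℘[L] z +
      1 / 2 * (∑ c ∈ S', eval (psiC L S z) (Nc L c) / eval (psiC L S z) (Dc L c)) - KC L S) *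
        qfun L S z) := by
    rw [PC]
    simp only [map_mul, map_add, map_sub, eval_C, eval_X, map_sum, map_prod, psiC_apply_zero]
    rw [← hS', hsum, hQz]
    ring
  rw [hPz]
  apply mul_left_cancel₀ (pow_ne_zero 2 hα0)
  rw [← mul_assoc, mul_inv_cancel₀ (pow_ne_zero 2 hα0), one_mul]
  linear_combination -(qfun L S z / 2) * key

/-! ### The multiplication-by-`α` map `cmul : C_α → E_L` as a polynomial map -/

variable (L α S)

/-- **The polynomial vector field `V` on `𝔸³` restricting to `ψ′` along `ψ`**:
`V = (2y, 3x² + A, −(Σ_c ∏_{c' ≠ c} D_{c'} · 2(x − e_c) · 2y) w²)`, `V(ψ(z)) = ψ′(z)`. [folklore] -/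
def VC : Fin 3 → MvPolynomial (Fin 3) ℂ :=
  ![C 2 * X 1, C 3 * X 0 ^ 2 + C (A L),
    -(∑ c ∈ S.erase 0, (∏ c' ∈ (S.erase 0).erase c, Dc L c') *
      (C 2 * (X 0 - C (℘[L] c)) * (C 2 * X 1))) * X 2 ^ 2]

/-- The `x`-coordinate `P(x) · w` of `[α]` (`= P(x)/Q(x) = ℘(αz)` on `C_α`).
[cite: Cox2013, §10.B Thm. 10.14] -/
def cmulX : MvPolynomial (Fin 3) ℂ := PC L α S * X 2

/-- The `y`-coordinate `(2α)⁻¹ · V(P w)` of `[α]` (`= ℘′(αz)/2` on `C_α`: `y = ½ dx/dz` and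
`d/dz = α⁻¹ d/d(αz)`). [folklore] -/
def cmulY : MvPolynomial (Fin 3) ℂ :=
  C (α⁻¹ * 2⁻¹) * ∑ i, pderiv i (cmulX L α S) * VC L S i

/-- **The multiplication-by-`α` map** `cmul = (x(αP), y(αP)) : C_α → E_L` as a polynomial map in
`(x, y, w)`. [cite: Cox2013, §10.B Thm. 10.14] -/
def cmul : Fin 2 → MvPolynomial (Fin 3) ℂ := ![cmulX L α S, cmulY L α S]

variable {L α S}

/-- `V(ψ(z)) = ψ′(z)`. [folklore] -/
theorem eval_VC (z : ℂ) : ∀ i, eval (psiC L S z) (VC L S i) = psiCD L S z i := by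
  intro i
  fin_cases i
  · simp only [VC, Fin.zero_eta, Matrix.cons_val_zero, map_mul, eval_C, eval_X, psiC_apply_one,
      psiCD_apply_zero]
    ring
  · simp only [VC, Fin.mk_one, Matrix.cons_val_one, Matrix.cons_val_zero, map_add, map_mul,
      eval_C, map_pow, eval_X, psiC_apply_zero, psiCD_apply_one, A]
    ring
  · simp only [VC, Fin.reduceFinMk, Matrix.cons_val, map_mul, map_neg, map_sum, map_prod,
      map_sub, map_pow, eval_C, eval_X, psiC_apply_zero, psiC_apply_one, psiC_apply_two,
      psiCD_apply_two, qfunD, Dc]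
    have e : ∀ c ∈ S.erase 0,
        (∏ x ∈ (S.erase 0).erase c, (℘[L] z - ℘[L] x) ^ 2) *
            (2 * (℘[L] z - ℘[L] c) * (2 * (℘'[L] z / 2))) =
          (∏ x ∈ (S.erase 0).erase c, (℘[L] z - ℘[L] x) ^ 2) * (2 * (℘[L] z - ℘[L] c) * ℘'[L] z) :=
      fun c _ => by ring
    rw [Finset.sum_congr rfl e]
    ring

section Alg

variable (hR : CMReps L α S) (h₂ : IsAlgebraic ℚ L.g₂) (h₃ : IsAlgebraic ℚ L.g₃)
include hR h₂ h₃

/-- `V` is over `ℚ̄`. [folklore] -/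
theorem CMReps.hasAlgCoeffs_VC : ∀ i, HasAlgCoeffs (VC L S i) := by
  have h2 : HasAlgCoeffs (C (2 : ℂ) : MvPolynomial (Fin 3) ℂ) := hasAlgCoeffs_C (isAlgebraic_nat 2)
  intro i
  fin_cases i
  · simpa [VC] using h2.mul (hasAlgCoeffs_X 1)
  · simpa [VC] using ((hasAlgCoeffs_C (isAlgebraic_nat 3)).mul ((hasAlgCoeffs_X 0).pow 2)).add
      (hasAlgCoeffs_C (isAlgebraic_A L h₂))
  · show HasAlgCoeffs (-(∑ c ∈ S.erase 0, (∏ c' ∈ (S.erase 0).erase c, Dc L c') *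
      (C 2 * (X 0 - C (℘[L] c)) * (C 2 * X 1))) * X 2 ^ 2)
    exact ((hasAlgCoeffs_finsetSum _ _ fun c hc =>
      (hasAlgCoeffs_finsetProd _ (fun c' => Dc L c') fun c' hc' =>
        hR.hasAlgCoeffs_Dc h₂ h₃ (Finset.mem_of_mem_erase hc')).mul
      ((h2.mul ((hasAlgCoeffs_X 0).sub (hasAlgCoeffs_C
        (hR.isAlgPt_rep h₂ h₃ hc).weierstrassP))).mul (h2.mul (hasAlgCoeffs_X 1))))).neg.mul
      ((hasAlgCoeffs_X 2).pow 2)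

/-- `x ∘ [α]` is over `ℚ̄`. [folklore] -/
theorem CMReps.hasAlgCoeffs_cmulX : HasAlgCoeffs (cmulX L α S) :=
  (hR.hasAlgCoeffs_PC h₂ h₃).mul (hasAlgCoeffs_X 2)

/-- `y ∘ [α]` is over `ℚ̄`. [folklore] -/
theorem CMReps.hasAlgCoeffs_cmulY : HasAlgCoeffs (cmulY L α S) :=
  (hasAlgCoeffs_C (hR.isAlgebraic_inv.mul (isAlgebraic_nat 2).inv)).mul
    (hasAlgCoeffs_finsetSum _ _ fun i _ =>
      ((hR.hasAlgCoeffs_cmulX h₂ h₃).pderiv i).mul (hR.hasAlgCoeffs_VC h₂ h₃ i))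

/-- `cmul` is over `ℚ̄`. [folklore] -/
theorem CMReps.hasAlgCoeffs_cmul : ∀ j, HasAlgCoeffs (cmul L α S j) := by
  intro j
  fin_cases j
  · simpa [cmul] using hR.hasAlgCoeffs_cmulX h₂ h₃
  · simpa [cmul] using hR.hasAlgCoeffs_cmulY h₂ h₃

end Alg

/-- `α(z + t) ∉ Λ` for small real `t` when `αz ∉ Λ`. [folklore] -/
theorem eventually_shift_mul_notMem {z : ℂ} (hz : α * z ∉ L.lattice) :
    ∀ᶠ t : ℝ in 𝓝 0, α * (z + (t : ℂ)) ∉ L.lattice := by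
  have hc : Continuous fun t : ℝ => α * (z + (t : ℂ)) := by fun_prop
  have h : (L.lattice : Set ℂ)ᶜ ∈ 𝓝 (α * (z + ((0 : ℝ) : ℂ))) := by
    simpa using L.isClosed_lattice.isOpen_compl.mem_nhds hz
  exact hc.continuousAt.preimage_mem_nhds h

/-- **`x([α](ψ(z))) = ℘(αz)`**: `P(℘ z) · Q(℘ z)⁻¹ = ℘(αz)`. [cite: Cox2013, §10.B Thm. 10.14] -/
theorem CMReps.eval_cmulX_psiC (hR : CMReps L α S) {z : ℂ} (hz : α * z ∉ L.lattice) :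
    eval (psiC L S z) (cmulX L α S) = ℘[L] (α * z) := by
  rw [cmulX, map_mul, eval_X, hR.eval_PC_psiC hz, psiC_apply_two, mul_assoc,
    mul_comm (℘[L] (α * z)), ← mul_assoc, mul_inv_cancel₀ (hR.qfun_ne_zero hz), one_mul]

/-- **`Dx∘[α](ψ(z)) ψ′(z) = α℘′(αz)`**: the derivative at `t = 0` of
`t ↦ x([α](ψ(z + t))) = ℘(αz + tα)`. [folklore] -/
theorem CMReps.pair_pderiv_cmulX (hR : CMReps L α S) {z : ℂ} (hz : α * z ∉ L.lattice) :
    ∑ i, eval (psiC L S z) (pderiv i (cmulX L α S)) * psiCD L S z i = ℘'[L] (α * z) * α := by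
  have hzΛ := hR.notMem_of_mul_notMem hz
  have hq := hR.qfun_ne_zero hz
  have hD := hasDerivAt_eval_psiC_shift hzΛ hq (cmulX L α S)
  have hE : (fun t : ℝ => phi L (α * z + t * α) 0) =ᶠ[𝓝 0]
      fun t : ℝ => eval (psiC L S (z + t)) (cmulX L α S) := by
    filter_upwards [eventually_shift_mul_notMem hz] with t ht
    rw [hR.eval_cmulX_psiC ht, phi_apply_zero, mul_add, mul_comm α (t : ℂ)]
  have hD2 : HasDerivAt (fun t : ℝ => phi L (α * z + t * α) 0)
      (phiD L (α * z + ((0 : ℝ) : ℂ) * α) 0 * α) 0 :=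
    hasDerivAt_phi_line L (α * z) α (by simpa using hz) 0
  have h := hD.unique (hD2.congr_of_eventuallyEq hE.symm)
  rw [h]
  simp

/-- **`y([α](ψ(z))) = ℘′(αz)/2`.** [folklore] -/
theorem CMReps.eval_cmulY_psiC (hR : CMReps L α S) {z : ℂ} (hz : α * z ∉ L.lattice) :
    eval (psiC L S z) (cmulY L α S) = ℘'[L] (α * z) / 2 := by
  rw [cmulY, map_mul, eval_C, map_sum]
  have e : ∑ i, eval (psiC L S z) (pderiv i (cmulX L α S) * VC L S i) =
      ∑ i, eval (psiC L S z) (pderiv i (cmulX L α S)) * psiCD L S z i :=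
    Finset.sum_congr rfl fun i _ => by rw [map_mul, eval_VC]
  rw [e, hR.pair_pderiv_cmulX hz]
  field_simp [hR.ne_zero]

/-- **`[α](ψ(z)) = φ(αz)`.** [cite: Cox2013, §10.B Thm. 10.14] -/
theorem CMReps.cmul_psiC (hR : CMReps L α S) {z : ℂ} (hz : α * z ∉ L.lattice) :
    (fun j => eval (psiC L S z) (cmul L α S j)) = phi L (α * z) := by
  funext j
  fin_cases j
  · simpa [cmul] using hR.eval_cmulX_psiC hz
  · simpa [cmul] using hR.eval_cmulY_psiC hz

/-- `[α]` maps `C_α` into `E_L`. [folklore] -/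
theorem CMReps.cmul_mapsTo (hR : CMReps L α S) :
    ∀ q ∈ (curveC L S).points, (fun j => eval q (cmul L α S j)) ∈ (curve L).points := by
  intro q hq
  obtain ⟨z, hz, hqz, rfl⟩ := exists_psiC_eq hq
  have hαz := hR.mul_notMem_of_qfun_ne_zero hz hqz
  rw [hR.cmul_psiC hαz]
  exact phi_mem_points L hαz

/-- **`D[α](ψ(z)) ψ′(z) = α φ′(αz)`**: the derivative at `t = 0` of `t ↦ [α](ψ(z + t)) = φ(αz + tα)`.
[folklore] -/
theorem CMReps.pair_pderiv_cmul (hR : CMReps L α S) {z : ℂ} (hz : α * z ∉ L.lattice) (j : Fin 2) :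
    ∑ i, eval (psiC L S z) (pderiv i (cmul L α S j)) * psiCD L S z i = phiD L (α * z) j * α := by
  have hzΛ := hR.notMem_of_mul_notMem hz
  have hq := hR.qfun_ne_zero hz
  have hD := hasDerivAt_eval_psiC_shift hzΛ hq (cmul L α S j)
  have hE : (fun t : ℝ => phi L (α * z + t * α) j) =ᶠ[𝓝 0]
      fun t : ℝ => eval (psiC L S (z + t)) (cmul L α S j) := by
    filter_upwards [eventually_shift_mul_notMem hz] with t ht
    rw [show α * z + (t : ℂ) * α = α * (z + (t : ℂ)) by ring]
    exact (congrFun (hR.cmul_psiC ht) j).symm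
  have hD2 : HasDerivAt (fun t : ℝ => phi L (α * z + t * α) j)
      (phiD L (α * z + ((0 : ℝ) : ℂ) * α) j * α) 0 :=
    hasDerivAt_phi_line L (α * z) α (by simpa using hz) j
  have h := hD.unique (hD2.congr_of_eventuallyEq hE.symm)
  rw [h]
  simp

/-- `ι(ψ(z)) = φ(z)`. [folklore] -/
theorem iota_psiC (z : ℂ) : (fun j => eval (psiC L S z) (iota j)) = phi L z := by
  rw [iota_eval]
  rfl

/-- `ι` maps `C_α` into `E_L`. [folklore] -/
theorem iota_mapsTo_C : ∀ q ∈ (curveC L S).points, (fun j => eval q (iota j)) ∈ (curve L).points := by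
  intro q hq
  rw [iota_eval, Weier.mem_points_iff, Weier.eval_fPoly]
  rw [mem_points_curveC_iff] at hq
  simpa using hq.1

/-- `Dι(ψ(z)) ψ′(z) = φ′(z)`. [folklore] -/
theorem pair_pderiv_iota_C (z : ℂ) (j : Fin 2) :
    ∑ i, eval (psiC L S z) (pderiv i (iota j)) * psiCD L S z i = phiD L z j := by
  fin_cases j <;> simp [iota, Pi.single_apply]

/-! ### The exact part: `G = (2/α) Σ_{c ≠ 0} (ζ(z − c) − ζ(z) + ζ(c))` as a polynomial on `C_α` -/

variable (L α S)

/-- `λ_c = (y + ℘′(c)/2) · w · (x − e_c) ∏_{c' ≠ c} D_{c'}` (`= ½ (℘′(z) + ℘′(c))/(℘(z) − ℘(c))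
= ζ(z − c) − ζ(z) + ζ(c)` on `C_α`). [cite: ArmitageEberlein2001, §7.4.2] -/
def lamC (c : ℂ) : MvPolynomial (Fin 3) ℂ :=
  (X 1 + C (℘'[L] c / 2)) * X 2 * ((X 0 - C (℘[L] c)) * ∏ c' ∈ (S.erase 0).erase c, Dc L c')

/-- **The exact part `G = (2/α) Σ_{c ∈ S ∖ 0} λ_c`** of `[α]^*θ₁`. [folklore] -/
def GC : MvPolynomial (Fin 3) ℂ := C (2 / α) * ∑ c ∈ S.erase 0, lamC L S c

variable {L α S}

section Lam

variable (hR : CMReps L α S)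
include hR

/-- `λ_c(ψ(z)) = ½ (℘′(z) + ℘′(c))/(℘(z) − ℘(c))` for `αz ∉ Λ`. [folklore] -/
theorem CMReps.eval_lamC_psiC {z c : ℂ} (hz : α * z ∉ L.lattice) (hc : c ∈ S.erase 0) :
    eval (psiC L S z) (lamC L S c) = (℘'[L] z + ℘'[L] c) / (℘[L] z - ℘[L] c) / 2 := by
  classical
  have hne : ℘[L] z - ℘[L] c ≠ 0 := sub_ne_zero.2 (hR.ne_of_mul_notMem hz hc).2.2
  set R := ∏ c' ∈ (S.erase 0).erase c, (℘[L] z - ℘[L] c') ^ 2 with hRdef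
  have hQ : qfun L S z = (℘[L] z - ℘[L] c) ^ 2 * R := by
    rw [qfun, ← Finset.mul_prod_erase _ _ hc]
  have hR0 : R ≠ 0 := by
    intro h
    exact hR.qfun_ne_zero hz (by rw [hQ, h, mul_zero])
  simp only [lamC, map_mul, map_add, map_sub, map_prod, map_pow, eval_X, eval_C, psiC_apply_zero,
    psiC_apply_one, psiC_apply_two, Dc]
  rw [← hRdef, hQ]
  field_simp

/-- `λ_c(ψ(z)) = ζ(z − c) − ζ(z) + ζ(c)` (the addition theorem for `ζ`,
`PeriodPair.weierstrassZeta_add_holds`, at `(z, −c)`). [cite: ArmitageEberlein2001, §7.4.2] -/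
theorem CMReps.eval_lamC_psiC_eq_zeta {z c : ℂ} (hz : α * z ∉ L.lattice) (hc : c ∈ S.erase 0) :
    eval (psiC L S z) (lamC L S c) =
      L.weierstrassZeta (z - c) - L.weierstrassZeta z + L.weierstrassZeta c := by
  have hzΛ := hR.notMem_of_mul_notMem hz
  have hcΛ := hR.rep_notMem hc
  have hc' : -c ∉ L.lattice := fun h => hcΛ (by simpa using neg_mem h)
  have hne := (hR.ne_of_mul_notMem hz hc).2.2
  have hne' : ℘[L] z ≠ ℘[L] (-c) := by rwa [L.weierstrassP_neg]
  have h := L.weierstrassZeta_add_holds z (-c) hzΛ hc' hne'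
  rw [L.weierstrassP_neg, L.derivWeierstrassP_neg, L.weierstrassZeta_neg, ← sub_eq_add_neg] at h
  rw [hR.eval_lamC_psiC hz hc, h]
  ring

/-- `G(ψ(z)) = (2/α) Σ_{c ≠ 0} (ζ(z − c) − ζ(z) + ζ(c))`. [folklore] -/
theorem CMReps.eval_GC_psiC {z : ℂ} (hz : α * z ∉ L.lattice) :
    eval (psiC L S z) (GC L α S) = 2 / α * ∑ c ∈ S.erase 0,
      (L.weierstrassZeta (z - c) - L.weierstrassZeta z + L.weierstrassZeta c) := by
  rw [GC, map_mul, eval_C, map_sum]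
  congr 1
  exact Finset.sum_congr rfl fun c hc => hR.eval_lamC_psiC_eq_zeta hz hc

/-- **`DG(ψ(z)) ψ′(z) = (2/α) Σ_{c ≠ 0} (℘(z) − ℘(z − c))`** (`ζ′ = −℘`). [folklore] -/
theorem CMReps.pair_pderiv_GC {z : ℂ} (hz : α * z ∉ L.lattice) :
    ∑ i, eval (psiC L S z) (pderiv i (GC L α S)) * psiCD L S z i =
      2 / α * ∑ c ∈ S.erase 0, (℘[L] z - ℘[L] (z - c)) := by
  have hzΛ := hR.notMem_of_mul_notMem hz
  have hq := hR.qfun_ne_zero hz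
  have hD := hasDerivAt_eval_psiC_shift hzΛ hq (GC L α S)
  -- `ζ′ = −℘` off the lattice
  have hζ : ∀ w, w ∉ L.lattice → HasDerivAt L.weierstrassZeta (-℘[L] w) w := fun w hw => by
    have hd : DifferentiableAt ℂ L.weierstrassZeta w :=
      L.differentiableOn_weierstrassZeta_holds.differentiableAt
        (L.isClosed_lattice.isOpen_compl.mem_nhds hw)
    rw [← L.deriv_weierstrassZeta_holds w hw]
    exact hd.hasDerivAt
  have hE : (fun t : ℝ => 2 / α * ∑ c ∈ S.erase 0, (L.weierstrassZeta (z - c + t) -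
      L.weierstrassZeta (z + t) + L.weierstrassZeta c)) =ᶠ[𝓝 0]
      fun t : ℝ => eval (psiC L S (z + t)) (GC L α S) := by
    filter_upwards [eventually_shift_mul_notMem hz] with t ht
    rw [hR.eval_GC_psiC ht]
    congr 1
    refine Finset.sum_congr rfl fun c _ => ?_
    rw [show z + (t : ℂ) - c = z - c + t by ring]
  have hsummand : ∀ c ∈ S.erase 0, HasDerivAt (fun t : ℝ => L.weierstrassZeta (z - c + t) -
      L.weierstrassZeta (z + t) + L.weierstrassZeta c) (-℘[L] (z - c) * 1 - -℘[L] z * 1) 0 := by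
    intro c hc
    have hzc : z - c ∉ L.lattice := (hR.ne_of_mul_notMem hz hc).1
    have h1 : HasDerivAt (fun t : ℝ => L.weierstrassZeta (z - c + t)) (-℘[L] (z - c) * 1) 0 := by
      have hin : HasDerivAt (fun s : ℂ => z - c + s) 1 ((0 : ℝ) : ℂ) := by
        simpa using (hasDerivAt_id (((0 : ℝ) : ℂ))).const_add (z - c)
      have h := ((hζ _ (by simpa using hzc)).comp ((0 : ℝ) : ℂ) hin).comp_ofReal
      simpa using h
    have h2 : HasDerivAt (fun t : ℝ => L.weierstrassZeta (z + t)) (-℘[L] z * 1) 0 := by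
      have hin : HasDerivAt (fun s : ℂ => z + s) 1 ((0 : ℝ) : ℂ) := by
        simpa using (hasDerivAt_id (((0 : ℝ) : ℂ))).const_add z
      have h := ((hζ _ (by simpa using hzΛ)).comp ((0 : ℝ) : ℂ) hin).comp_ofReal
      simpa using h
    exact (h1.sub h2).add_const _
  have hD2 := (HasDerivAt.fun_sum hsummand).const_mul (2 / α)
  have h := hD.unique (hD2.congr_of_eventuallyEq hE.symm)
  rw [h]
  congr 1
  refine Finset.sum_congr rfl fun c _ => ?_
  ring

end Lam

/-! ### The identities of forms on `C_α` -/

variable (L α S)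

/-- The coefficient `b = |S|/α` (`= ᾱ`, the degree of `[α]` being `|S| = αᾱ`). [folklore] -/
def bC : ℂ := (S.card : ℂ) / α

/-- The coefficient `a = −K/α`. [folklore] -/
def aC : ℂ := -(KC L S / α)

/-- `ν₀ = [α]^*θ₀ − α · ι^*θ₀`. [folklore] -/
def nuC0 : Fin 3 → MvPolynomial (Fin 3) ℂ :=
  formPullback (cmul L α S) (theta0 L) - α • formPullback iota (theta0 L)

/-- `ν₁ = [α]^*θ₁ − b · ι^*θ₁ − a · ι^*θ₀ + dG`. [folklore] -/
def nuC1 : Fin 3 → MvPolynomial (Fin 3) ℂ :=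
  formPullback (cmul L α S) (theta1 L) - bC α S • formPullback iota (theta1 L) -
    aC L α S • formPullback iota (theta0 L) + formD (GC L α S)

variable {L α S}

section Forms

variable (hR : CMReps L α S)
include hR

/-- `b ∈ ℚ̄`. [folklore] -/
theorem CMReps.isAlgebraic_bC : IsAlgebraic ℚ (bC α S) := by
  rw [bC, div_eq_mul_inv]
  exact (isAlgebraic_nat _).mul hR.isAlgebraic_inv

/-- `a ∈ ℚ̄`. [folklore] -/
theorem CMReps.isAlgebraic_aC (h₂ : IsAlgebraic ℚ L.g₂) (h₃ : IsAlgebraic ℚ L.g₃) :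
    IsAlgebraic ℚ (aC L α S) := by
  rw [aC, div_eq_mul_inv]
  exact ((hR.isAlgebraic_KC h₂ h₃).mul hR.isAlgebraic_inv).neg

/-- `λ_c` is over `ℚ̄`. [folklore] -/
theorem CMReps.hasAlgCoeffs_lamC (h₂ : IsAlgebraic ℚ L.g₂) (h₃ : IsAlgebraic ℚ L.g₃) {c : ℂ}
    (hc : c ∈ S.erase 0) : HasAlgCoeffs (lamC L S c) := by
  have hP := hR.isAlgPt_rep h₂ h₃ hc
  unfold lamC
  exact (((hasAlgCoeffs_X 1).add (hasAlgCoeffs_C (hP.derivWeierstrassP.mul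
    (isAlgebraic_nat 2).inv))).mul (hasAlgCoeffs_X 2)).mul
    (((hasAlgCoeffs_X 0).sub (hasAlgCoeffs_C hP.weierstrassP)).mul
      (hasAlgCoeffs_finsetProd _ (fun c' => Dc L c') fun c' hc' =>
        hR.hasAlgCoeffs_Dc h₂ h₃ (Finset.mem_of_mem_erase hc')))

/-- `G` is over `ℚ̄`. [folklore] -/
theorem CMReps.hasAlgCoeffs_GC (h₂ : IsAlgebraic ℚ L.g₂) (h₃ : IsAlgebraic ℚ L.g₃) :
    HasAlgCoeffs (GC L α S) := by
  unfold GC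
  refine (hasAlgCoeffs_C ?_).mul (hasAlgCoeffs_finsetSum _ (fun c => lamC L S c) fun c hc =>
    hR.hasAlgCoeffs_lamC h₂ h₃ hc)
  rw [div_eq_mul_inv]
  exact (isAlgebraic_nat 2).mul hR.isAlgebraic_inv

/-- **`[α]^*θ₀ = α ι^*θ₀` on `C_α`** (`[α]^* dz = α dz`): `ν₀` vanishes on `C_α`.
[cite: HuberWustholz2022, §18.1 (p. 160)] [cite: SilvermanAEC2009, III.5.1] -/
theorem CMReps.vanishesOn_nuC0 (hE : (curveC L S).IsSmoothAffineCurve) :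
    VanishesOn (curveC L S) (nuC0 L α S) := by
  refine vanishesOn_curveC_of_psi hE _ fun z hzΛ hq => ?_
  have hz : α * z ∉ L.lattice := hR.mul_notMem_of_qfun_ne_zero hzΛ hq
  have e : ∀ i, eval (psiC L S z) (nuC0 L α S i) * psiCD L S z i =
      eval (psiC L S z) (formPullback (cmul L α S) (theta0 L) i) * psiCD L S z i -
        α * (eval (psiC L S z) (formPullback iota (theta0 L) i) * psiCD L S z i) := fun i => by
    simp only [nuC0, Pi.sub_apply, Pi.smul_apply, map_sub, smul_eval]
    ring
  rw [Finset.sum_congr rfl fun i _ => e i, Finset.sum_sub_distrib, ← Finset.mul_sum,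
    formPullback_pair, formPullback_pair, hR.cmul_psiC hz, iota_psiC]
  have hs1 : ∑ j, eval (phi L (α * z)) (theta0 L j) *
      (∑ i, eval (psiC L S z) (pderiv i (cmul L α S j)) * psiCD L S z i) =
      α * ∑ j, eval (phi L (α * z)) (theta0 L j) * phiD L (α * z) j := by
    rw [Finset.mul_sum]
    exact Finset.sum_congr rfl fun j _ => by rw [hR.pair_pderiv_cmul hz j]; ring
  have hs2 : ∑ j, eval (phi L z) (theta0 L j) *
      (∑ i, eval (psiC L S z) (pderiv i (iota j)) * psiCD L S z i) =
      ∑ j, eval (phi L z) (theta0 L j) * phiD L z j :=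
    Finset.sum_congr rfl fun j _ => by rw [pair_pderiv_iota_C z j]
  rw [hs1, hs2, theta0_phi L hz, theta0_phi L hzΛ, sub_self]

/-- **`[α]^*θ₁ = (|S|/α) ι^*θ₁ − (K/α) ι^*θ₀ − dG` on `C_α`** (`α℘(αz)dz =
(|S|/α)℘(z)dz − (K/α)dz − dG(ψ(z))`, the transformation formula
`α²℘(αz) = ℘(z) + Σ_{c ≠ 0} ℘(z − c) − K`): `ν₁` vanishes on `C_α`.
[cite: Lawden1989, §9.8 eq. (9.8.14)] [cite: HuberWustholz2022, §18.1 (p. 160)] -/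
theorem CMReps.vanishesOn_nuC1 (hE : (curveC L S).IsSmoothAffineCurve) :
    VanishesOn (curveC L S) (nuC1 L α S) := by
  classical
  refine vanishesOn_curveC_of_psi hE _ fun z hzΛ hq => ?_
  have hz : α * z ∉ L.lattice := hR.mul_notMem_of_qfun_ne_zero hzΛ hq
  have hα0 := hR.ne_zero
  have e : ∀ i, eval (psiC L S z) (nuC1 L α S i) * psiCD L S z i =
      eval (psiC L S z) (formPullback (cmul L α S) (theta1 L) i) * psiCD L S z i -
        bC α S * (eval (psiC L S z) (formPullback iota (theta1 L) i) * psiCD L S z i) -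
        aC L α S * (eval (psiC L S z) (formPullback iota (theta0 L) i) * psiCD L S z i) +
        eval (psiC L S z) (pderiv i (GC L α S)) * psiCD L S z i := fun i => by
    simp only [nuC1, formD, Pi.sub_apply, Pi.add_apply, Pi.smul_apply, map_sub, map_add, smul_eval]
    ring
  rw [Finset.sum_congr rfl fun i _ => e i, Finset.sum_add_distrib, Finset.sum_sub_distrib,
    Finset.sum_sub_distrib, ← Finset.mul_sum, ← Finset.mul_sum,
    formPullback_pair, formPullback_pair, formPullback_pair, hR.cmul_psiC hz, iota_psiC,
    hR.pair_pderiv_GC hz]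
  have hs1 : ∑ j, eval (phi L (α * z)) (theta1 L j) *
      (∑ i, eval (psiC L S z) (pderiv i (cmul L α S j)) * psiCD L S z i) =
      α * ∑ j, eval (phi L (α * z)) (theta1 L j) * phiD L (α * z) j := by
    rw [Finset.mul_sum]
    exact Finset.sum_congr rfl fun j _ => by rw [hR.pair_pderiv_cmul hz j]; ring
  have hs2 : ∑ j, eval (phi L z) (theta1 L j) *
      (∑ i, eval (psiC L S z) (pderiv i (iota j)) * psiCD L S z i) =
      ∑ j, eval (phi L z) (theta1 L j) * phiD L z j :=
    Finset.sum_congr rfl fun j _ => by rw [pair_pderiv_iota_C z j]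
  have hs3 : ∑ j, eval (phi L z) (theta0 L j) *
      (∑ i, eval (psiC L S z) (pderiv i (iota j)) * psiCD L S z i) =
      ∑ j, eval (phi L z) (theta0 L j) * phiD L z j :=
    Finset.sum_congr rfl fun j _ => by rw [pair_pderiv_iota_C z j]
  rw [hs1, hs2, hs3, theta1_phi L hz, theta1_phi L hzΛ, theta0_phi L hzΛ]
  -- the transformation formula
  have h1 := PeriodPair.weierstrassP_mul_eq_sum_sub (L := L) hα0 hR.zero_mem hR.reps hR.distinct hz
  have hsplit : ∑ c ∈ S, ℘[L] (z - c) = ℘[L] z + ∑ c ∈ S.erase 0, ℘[L] (z - c) := by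
    rw [← Finset.add_sum_erase S _ hR.zero_mem, sub_zero]
  have hcard : (S.card : ℂ) = (S.erase 0).card + 1 := by
    rw [← Finset.card_erase_add_one hR.zero_mem]
    push_cast
    ring
  have hsum' : ∑ c ∈ S.erase 0, (℘[L] z - ℘[L] (z - c)) =
      (S.erase 0).card * ℘[L] z - ∑ c ∈ S.erase 0, ℘[L] (z - c) := by
    rw [Finset.sum_sub_distrib, Finset.sum_const, nsmul_eq_mul]
  rw [hsum']
  simp only [bC, aC, KC]
  rw [hsplit] at h1
  field_simp
  linear_combination 2 * h1 - 2 * ℘[L] z * hcard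

end Forms

/-! ### Algebraic points and the lifted path `ψ ∘ g` on `C_α` -/

/-- `Q(℘(z)) ∈ ℚ̄` at an algebraic point. [folklore] -/
theorem CMReps.isAlgebraic_qfun (hR : CMReps L α S) (h₂ : IsAlgebraic ℚ L.g₂)
    (h₃ : IsAlgebraic ℚ L.g₃) {z : ℂ} (hz : IsAlgPt L z) : IsAlgebraic ℚ (qfun L S z) := by
  have h : qfun L S z = eval (![℘[L] z, 0, 0]) (QC L S) := by rw [eval_QC]; rfl
  rw [h]
  refine (hR.hasAlgCoeffs_QC h₂ h₃).isAlgebraic_eval fun k => ?_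
  fin_cases k
  · simpa using hz.weierstrassP
  · simpa using isAlgebraic_zero
  · simpa using isAlgebraic_zero

/-- The coordinates of `ψ(z)` are algebraic at an algebraic point. [folklore] -/
theorem CMReps.isAlgebraic_psiC (hR : CMReps L α S) (h₂ : IsAlgebraic ℚ L.g₂)
    (h₃ : IsAlgebraic ℚ L.g₃) {z : ℂ} (hz : IsAlgPt L z) : ∀ k, IsAlgebraic ℚ (psiC L S z k) := by
  intro k
  fin_cases k
  · simpa using hz.2 0
  · simpa using hz.2 1
  · simpa using (hR.isAlgebraic_qfun h₂ h₃ hz).inv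

/-- **`αz` is an algebraic point if `z` is** (and `αz ∉ Λ`): `φ(αz) = [α](ψ(z))` with `[α]` over
`ℚ̄` — complex multiplications are defined over `ℚ̄`. [cite: Cox2013, §10.B Thm. 10.14] -/
theorem CMReps.isAlgPt_mul (hR : CMReps L α S) (h₂ : IsAlgebraic ℚ L.g₂) (h₃ : IsAlgebraic ℚ L.g₃)
    {z : ℂ} (hz : IsAlgPt L z) (hαz : α * z ∉ L.lattice) : IsAlgPt L (α * z) := by
  refine ⟨hαz, fun k => ?_⟩
  rw [← congrFun (hR.cmul_psiC hαz) k]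
  exact (hR.hasAlgCoeffs_cmul h₂ h₃ k).isAlgebraic_eval (hR.isAlgebraic_psiC h₂ h₃ hz)

/-- `G(ψ(z)) ∈ ℚ̄` at an algebraic point. [folklore] -/
theorem CMReps.isAlgebraic_eval_GC (hR : CMReps L α S) (h₂ : IsAlgebraic ℚ L.g₂)
    (h₃ : IsAlgebraic ℚ L.g₃) {z : ℂ} (hz : IsAlgPt L z) :
    IsAlgebraic ℚ (eval (psiC L S z) (GC L α S)) :=
  (hR.hasAlgCoeffs_GC h₂ h₃).isAlgebraic_eval (hR.isAlgebraic_psiC h₂ h₃ hz)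

/-- **The lifted path `ψ ∘ g` on `C_α`**, for a `C¹` map `g` whose values on `[0,1]` avoid `α⁻¹Λ`,
with algebraic end points. [folklore] -/
def CMReps.liftPathC (hR : CMReps L α S) (h₂ : IsAlgebraic ℚ L.g₂) (h₃ : IsAlgebraic ℚ L.g₃)
    (g : ℝ → ℂ) (hg : ContDiff ℝ 1 g) (hα : ∀ t ∈ Icc (0 : ℝ) 1, α * g t ∉ L.lattice)
    (h0 : IsAlgPt L (g 0)) (h1 : IsAlgPt L (g 1)) : CurvePath (curveC L S) where
  toFun t := psiC L S (g t)
  contDiffOn := by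
    have hΛ : ∀ t ∈ Icc (0 : ℝ) 1, g t ∉ L.lattice := fun t ht => hR.notMem_of_mul_notMem (hα t ht)
    have hφ : ∀ k : Fin 2, ContDiffOn ℝ 1 (fun t => phi L (g t) k) (Icc 0 1) := fun k =>
      (contDiffOn_phi L k).comp hg.contDiffOn fun t ht => hΛ t ht
    have hx := hφ 0
    have hy := hφ 1
    simp only [phi_apply_zero, phi_apply_one] at hx hy
    have hγ : ContDiffOn ℝ 1 (fun t => (![℘[L] (g t), 0, 0] : Fin 3 → ℂ)) (Icc 0 1) := by
      refine contDiffOn_pi.2 fun k => ?_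
      fin_cases k
      · exact hx
      · exact contDiffOn_const
      · exact contDiffOn_const
    have hq : ContDiffOn ℝ 1 (fun t => qfun L S (g t)) (Icc 0 1) := by
      have h := contDiffOn_eval_comp hγ (QC L S)
      refine h.congr fun t _ => ?_
      rw [eval_QC]
      rfl
    refine contDiffOn_pi.2 fun k => ?_
    fin_cases k
    · exact hx
    · exact hy
    · exact hq.inv fun t ht => hR.qfun_ne_zero (hα t ht)
  mem_points t ht := psiC_mem_points L S (hR.notMem_of_mul_notMem (hα t ht))
    (hR.qfun_ne_zero (hα t ht))
  algebraic_zero k := hR.isAlgebraic_psiC h₂ h₃ h0 k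
  algebraic_one k := hR.isAlgebraic_psiC h₂ h₃ h1 k

/-- The parametrisation of `liftPathC`. [folklore] -/
@[simp] theorem CMReps.liftPathC_toFun (hR : CMReps L α S) (h₂ : IsAlgebraic ℚ L.g₂)
    (h₃ : IsAlgebraic ℚ L.g₃) (g : ℝ → ℂ) (hg : ContDiff ℝ 1 g)
    (hα : ∀ t ∈ Icc (0 : ℝ) 1, α * g t ∉ L.lattice) (h0 : IsAlgPt L (g 0)) (h1 : IsAlgPt L (g 1))
    (t : ℝ) : (hR.liftPathC h₂ h₃ g hg hα h0 h1).toFun t = psiC L S (g t) := rfl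

/-! ### Complex multiplication is functoriality: the relations -/

section Relations

variable (hR : CMReps L α S) (h₂ : IsAlgebraic ℚ L.g₂) (h₃ : IsAlgebraic ℚ L.g₃)
include hR h₂ h₃

/-- **The CM relation for `θ₀ = dx/y`.** Let `α` be a complex multiplication of `Λ` (`αΛ ⊆ Λ`,
`α ≠ 0`) and `g : [0,1] → ℂ` a `C¹` map avoiding `α⁻¹Λ` with algebraic end points. Then
`(E_L, θ₀, φ∘(αg)) − α · (E_L, θ₀, φ∘g)` lies in the `ℚ̄`-span of the elementary relations:
functoriality (R4) along `[α] : C_α → E_L` and along `ι : C_α → E_L`, with `[α]^*θ₀ = α ι^*θ₀`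
in `Ω¹(C_α)`. This is the relation `∫_{[α]γ} dx/y = α ∫_γ dx/y` behind `ω₂ = τω₁` for a CM
curve ("induced by functoriality", Huber–Wüstholz 2022, Thm. 13.3 (2)).
[cite: HuberWustholz2022, Thm. 13.3 (2) (p. 121), §13.1 (B) (p. 120), §18.1 (p. 160)] [cite: Cox2013, §10.B Thm. 10.14] -/
theorem CMReps.span_cmul_theta0 {g : ℝ → ℂ} (hg : ContDiff ℝ 1 g)
    (hαg : ∀ t ∈ Icc (0 : ℝ) 1, α * g t ∉ L.lattice)
    (hΛ : ∀ t ∈ Icc (0 : ℝ) 1, g t ∉ L.lattice)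
    (h0 : IsAlgPt L (g 0)) (h1 : IsAlgPt L (g 1))
    (hg' : ContDiff ℝ 1 fun t => α * g t)
    (h0' : IsAlgPt L (α * g 0)) (h1' : IsAlgPt L (α * g 1)) :
    InSpan (Finsupp.single (⟨curve L, smooth L h₂ h₃, theta0 L, hasAlgCoeffs_theta0 L h₂ h₃,
        liftPath L (fun t => α * g t) hg' hαg h0' h1'⟩ : PeriodSymbol) (1 : ℂ) -
      α • Finsupp.single (⟨curve L, smooth L h₂ h₃, theta0 L, hasAlgCoeffs_theta0 L h₂ h₃,
        liftPath L g hg hΛ h0 h1⟩ : PeriodSymbol) 1) := by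
  have hE := smooth L h₂ h₃
  have hEC := hR.smoothC h₂ h₃
  have hθ := hasAlgCoeffs_theta0 L h₂ h₃
  have hιθ : ∀ i, HasAlgCoeffs (formPullback iota (theta0 L) i) :=
    HasAlgCoeffs.formPullback hasAlgCoeffs_iota hθ
  have hcθ : ∀ i, HasAlgCoeffs (formPullback (cmul L α S) (theta0 L) i) :=
    HasAlgCoeffs.formPullback (hR.hasAlgCoeffs_cmul h₂ h₃) hθ
  have hαιθ : ∀ i, HasAlgCoeffs ((α • formPullback iota (theta0 L)) i) := fun i =>
    (hιθ i).smul hR.isAlgebraic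
  have hν : ∀ i, HasAlgCoeffs (nuC0 L α S i) := fun i => (hcθ i).sub (hαιθ i)
  set Γ := hR.liftPathC h₂ h₃ g hg hαg h0 h1 with hΓ
  have rι := IsElementaryRelation.pushforward (curveC L S) (curve L) hEC hE iota hasAlgCoeffs_iota
    iota_mapsTo_C (theta0 L) hθ (formPullback iota (theta0 L)) hιθ rfl
    Γ (liftPath L g hg hΛ h0 h1) (fun t _ => by
      rw [iota_eval, liftPath_toFun, hΓ, CMReps.liftPathC_toFun]
      rfl)
  have rc := IsElementaryRelation.pushforward (curveC L S) (curve L) hEC hE (cmul L α S)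
    (hR.hasAlgCoeffs_cmul h₂ h₃) hR.cmul_mapsTo (theta0 L) hθ
    (formPullback (cmul L α S) (theta0 L)) hcθ rfl Γ (liftPath L (fun t => α * g t) hg' hαg h0' h1')
    (fun t ht => by rw [liftPath_toFun, hΓ, CMReps.liftPathC_toFun, hR.cmul_psiC (hαg t ht)])
  have radd := IsElementaryRelation.add (curveC L S) hEC Γ
    (formPullback (cmul L α S) (theta0 L)) (nuC0 L α S) (α • formPullback iota (theta0 L)) hcθ hν
    hαιθ (by rw [nuC0, sub_add_cancel])
  have rsmul := IsElementaryRelation.smul (curveC L S) hEC Γ α hR.isAlgebraic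
    (formPullback iota (theta0 L)) (α • formPullback iota (theta0 L)) hιθ hαιθ rfl
  have rvan := IsElementaryRelation.vanish (curveC L S) hEC Γ (nuC0 L α S) hν
    (hR.vanishesOn_nuC0 hEC)
  obtain ⟨k, ρ, cf, hρ, hcf, hsum⟩ :=
    span_add (span_add (span_add (span_sub (span_smul hR.isAlgebraic (span_of_rel rι))
      (span_of_rel rc)) (span_of_rel radd)) (span_of_rel rsmul)) (span_of_rel rvan)
  refine ⟨k, ρ, cf, hρ, hcf, ?_⟩
  rw [← hsum, smul_sub]
  abel

/-- **The CM relation for `θ₁ = x dx/y`, up to an algebraic constant.** With the notation of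
`span_cmul_theta0`,
`(E_L, θ₁, φ∘(αg)) − (|S|/α) (E_L, θ₁, φ∘g) + (K/α) (E_L, θ₀, φ∘g) + (G(ψ(g 1)) − G(ψ(g 0))) · 𝟙`
lies in the span, where `K = Σ_{c ≠ 0} ℘(c)` and
`G(ψ(z)) = (2/α) Σ_{c ≠ 0} (ζ(z − c) − ζ(z) + ζ(c)) ∈ ℚ̄` at algebraic `z`
(`[α]^*θ₁ = (|S|/α) ι^*θ₁ − (K/α) ι^*θ₀ − dG` in `Ω¹(C_α)`; (R3) for `dG`). This is the relation
behind Masser's CM relation between `η₁, η₂` (Lemma 3.1).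
[cite: HuberWustholz2022, Thm. 13.3 (2) (p. 121), §13.1 (B) (p. 120), §18.1 (p. 160)] [cite: Masser1975, Ch. III Lemma 3.1] -/
theorem CMReps.span_cmul_theta1 {g : ℝ → ℂ} (hg : ContDiff ℝ 1 g)
    (hαg : ∀ t ∈ Icc (0 : ℝ) 1, α * g t ∉ L.lattice)
    (hΛ : ∀ t ∈ Icc (0 : ℝ) 1, g t ∉ L.lattice)
    (h0 : IsAlgPt L (g 0)) (h1 : IsAlgPt L (g 1))
    (hg' : ContDiff ℝ 1 fun t => α * g t)
    (h0' : IsAlgPt L (α * g 0)) (h1' : IsAlgPt L (α * g 1)) :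
    InSpan (Finsupp.single (⟨curve L, smooth L h₂ h₃, theta1 L, hasAlgCoeffs_theta1 L h₂ h₃,
        liftPath L (fun t => α * g t) hg' hαg h0' h1'⟩ : PeriodSymbol) (1 : ℂ) -
      bC α S • Finsupp.single (⟨curve L, smooth L h₂ h₃, theta1 L, hasAlgCoeffs_theta1 L h₂ h₃,
        liftPath L g hg hΛ h0 h1⟩ : PeriodSymbol) 1 -
      aC L α S • Finsupp.single (⟨curve L, smooth L h₂ h₃, theta0 L, hasAlgCoeffs_theta0 L h₂ h₃,
        liftPath L g hg hΛ h0 h1⟩ : PeriodSymbol) 1 +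
      (eval (psiC L S (g 1)) (GC L α S) - eval (psiC L S (g 0)) (GC L α S)) •
        Finsupp.single PeriodSymbol.unit (1 : ℂ)) := by
  have hE := smooth L h₂ h₃
  have hEC := hR.smoothC h₂ h₃
  have hθ1 := hasAlgCoeffs_theta1 L h₂ h₃
  have hθ0 := hasAlgCoeffs_theta0 L h₂ h₃
  have hb := hR.isAlgebraic_bC
  have ha := hR.isAlgebraic_aC h₂ h₃
  have hG := hR.hasAlgCoeffs_GC h₂ h₃
  have hιθ1 : ∀ i, HasAlgCoeffs (formPullback iota (theta1 L) i) :=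
    HasAlgCoeffs.formPullback hasAlgCoeffs_iota hθ1
  have hιθ0 : ∀ i, HasAlgCoeffs (formPullback iota (theta0 L) i) :=
    HasAlgCoeffs.formPullback hasAlgCoeffs_iota hθ0
  have hcθ : ∀ i, HasAlgCoeffs (formPullback (cmul L α S) (theta1 L) i) :=
    HasAlgCoeffs.formPullback (hR.hasAlgCoeffs_cmul h₂ h₃) hθ1
  have hdG : ∀ i, HasAlgCoeffs (formD (GC L α S) i) := hG.formD
  have hbι : ∀ i, HasAlgCoeffs ((bC α S • formPullback iota (theta1 L)) i) := fun i =>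
    (hιθ1 i).smul hb
  have haι : ∀ i, HasAlgCoeffs ((aC L α S • formPullback iota (theta0 L)) i) := fun i =>
    (hιθ0 i).smul ha
  set W : Fin 3 → MvPolynomial (Fin 3) ℂ :=
    bC α S • formPullback iota (theta1 L) + aC L α S • formPullback iota (theta0 L) with hW
  set U : Fin 3 → MvPolynomial (Fin 3) ℂ :=
    formPullback (cmul L α S) (theta1 L) + formD (GC L α S) with hU
  have hWa : ∀ i, HasAlgCoeffs (W i) := fun i => (hbι i).add (haι i)
  have hUa : ∀ i, HasAlgCoeffs (U i) := fun i => (hcθ i).add (hdG i)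
  have hν : ∀ i, HasAlgCoeffs (nuC1 L α S i) := fun i =>
    (((hcθ i).sub (hbι i)).sub (haι i)).add (hdG i)
  have hdec : U = nuC1 L α S + W := by
    rw [hU, hW, nuC1]
    abel
  set Γ := hR.liftPathC h₂ h₃ g hg hαg h0 h1 with hΓ
  have rι1 := IsElementaryRelation.pushforward (curveC L S) (curve L) hEC hE iota hasAlgCoeffs_iota
    iota_mapsTo_C (theta1 L) hθ1 (formPullback iota (theta1 L)) hιθ1 rfl
    Γ (liftPath L g hg hΛ h0 h1) (fun t _ => by
      rw [iota_eval, liftPath_toFun, hΓ, CMReps.liftPathC_toFun]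
      rfl)
  have rι0 := IsElementaryRelation.pushforward (curveC L S) (curve L) hEC hE iota hasAlgCoeffs_iota
    iota_mapsTo_C (theta0 L) hθ0 (formPullback iota (theta0 L)) hιθ0 rfl
    Γ (liftPath L g hg hΛ h0 h1) (fun t _ => by
      rw [iota_eval, liftPath_toFun, hΓ, CMReps.liftPathC_toFun]
      rfl)
  have rc := IsElementaryRelation.pushforward (curveC L S) (curve L) hEC hE (cmul L α S)
    (hR.hasAlgCoeffs_cmul h₂ h₃) hR.cmul_mapsTo (theta1 L) hθ1
    (formPullback (cmul L α S) (theta1 L)) hcθ rfl Γ (liftPath L (fun t => α * g t) hg' hαg h0' h1')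
    (fun t ht => by rw [liftPath_toFun, hΓ, CMReps.liftPathC_toFun, hR.cmul_psiC (hαg t ht)])
  have raddU := IsElementaryRelation.add (curveC L S) hEC Γ U
    (formPullback (cmul L α S) (theta1 L)) (formD (GC L α S)) hUa hcθ hdG rfl
  have radd₁ := IsElementaryRelation.add (curveC L S) hEC Γ U (nuC1 L α S) W hUa hν hWa hdec
  have radd₂ := IsElementaryRelation.add (curveC L S) hEC Γ W
    (bC α S • formPullback iota (theta1 L)) (aC L α S • formPullback iota (theta0 L)) hWa hbι haι rfl
  have rsmul₁ := IsElementaryRelation.smul (curveC L S) hEC Γ (bC α S) hb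
    (formPullback iota (theta1 L)) (bC α S • formPullback iota (theta1 L)) hιθ1 hbι rfl
  have rsmul₂ := IsElementaryRelation.smul (curveC L S) hEC Γ (aC L α S) ha
    (formPullback iota (theta0 L)) (aC L α S • formPullback iota (theta0 L)) hιθ0 haι rfl
  have rvan := IsElementaryRelation.vanish (curveC L S) hEC Γ (nuC1 L α S) hν
    (hR.vanishesOn_nuC1 hEC)
  have rex := IsElementaryRelation.exact (curveC L S) hEC Γ (GC L α S) hG
    (formD (GC L α S)) hdG rfl
  have e1 : Γ.toFun 1 = psiC L S (g 1) := by rw [hΓ]; rfl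
  have e0 : Γ.toFun 0 = psiC L S (g 0) := by rw [hΓ]; rfl
  rw [e1, e0] at rex
  obtain ⟨k, ρ, cf, hρ, hcf, hsum⟩ :=
    span_sub (span_sub (span_sub (span_add (span_add (span_add (span_add (span_add (span_add
      (span_of_rel radd₁) (span_of_rel rvan)) (span_of_rel radd₂)) (span_of_rel rsmul₁))
      (span_smul hb (span_of_rel rι1))) (span_of_rel rsmul₂)) (span_smul ha (span_of_rel rι0)))
      (span_of_rel rex)) (span_of_rel raddU)) (span_of_rel rc)
  refine ⟨k, ρ, cf, hρ, hcf, ?_⟩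
  rw [← hsum, smul_sub, smul_sub]
  abel

end Relations

end Ell

end CurvePeriods

end Literature.NumberTheory.Transcendental

end
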